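import Literature.NumberTheory.LFunctions.HalaszRestricted
import Literature.NumberTheory.LFunctions.HalaszRestrictedShortMeanSquare
import HarnessLib

/-!
# Halász's theorem for block-restricted sums over multiplicative windows, II: the theorem

Second file (after `HalaszRestrictedShortMeanSquare.lean`; independent of the parallel `HalaszRestrictedShort*.lean`
series of the tree, which treats the same short differences by a different route).  For a completely multiplicative `g : ℕ → ℂ` with
`|g| ≤ 1`, a block system `blk i` (`i ∈ 𝓙`) of pairwise disjoint sets of primes and `𝒮 = {n : n has a prime factor
in every block}`, the tree's `Halasz.Restricted.norm_restr_sum_le` bounds the INITIAL sums `∑_{n ≤ x, n ∈ 𝒮} g(n)` by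
`K x ((1 + M_½) e^{-M_½} + 1/T + (|𝓙|+1)√((log Q + 2)/log x))`.  Here we prove the same for the sums over
MULTIPLICATIVE WINDOWS `(x, νx]`, `1 < ν ≤ 2`, with the natural size `(ν - 1) x` in place of `x`
(`norm_restr_interval_sum_le`):

`|∑_{x < n ≤ νx, n ∈ 𝒮} g(n)| ≤ K ( (ν-1) x ((1 + M_½) e^{-M_½} + 1/T + (|𝓙|+1) √((log Q + 2)/log x))`
`   + (|𝓙|+1) x (ν-1)^{-1/12}/√(log x) + x/log x + x/T + |E| )`,

`M_½ = min_{|t| ≤ T} 𝔻_½(g, n^{it}; νx)²`.  Differencing two initial sums would lose the factor `ν - 1`; this is the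
input for the `L²` treatment of the window `|t - t₁| ≤ (log X)^{1/16}` of Matomäki–Radziwiłł–Tao 2015,
Proposition A.3 for the restricted Dirichlet polynomial (by Gallagher's lemma the `L²` norm of
`F(1+it) = ∑_{X ≤ n ≤ 2X, n ∈ 𝒮} f(n) n^{-1-it}` over `|t - t₁| ≤ L` is controlled by the sums of `f n^{-it₁} 1_𝒮`
over windows of ratio `e^{π/L}`), which yields the middle term `(1 + M)² e^{-M}` and hence Theorem 1.7 of that
paper with the printed rate (`MRT2015.theorem17_of_propA3With_sq`).  Everything is PROVED; the two `def`s
(`Halasz.Sh`, `Halasz.normShExp`) are bookkeeping abbreviations; no named facts.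

The proof is Granville–Soundararajan's (Canad. J. Math. 2003) as run in the tree files `HalaszPartialSummation`,
`HalaszIntegration`, `HalaszRestricted`, for the window sums `S_ν(y) = S_a(νy) - S_a(y)` of `a = g̃ 1_𝒮`:

* `Halasz.Sh`, `Halasz.normShExp`, `Halasz.norm_Sh_mul_log_le_norm_sum` — window sums and Lemma A1 (signed
  form) over windows: `‖S_ν(y)‖ log y ≤ ‖∑_{y < n ≤ νy} a(n) log n‖ + (⌊νy⌋ - ⌊y⌋) log ν`;
* `Halasz.sum_vonMangoldt_mul_Sh_le`, `Halasz.sum_abs_psi_sub_mul_kk_window_le`, `Halasz.norm_Sh_div_sub_le`,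
  `Halasz.sum_norm_Sh_div_le` — Lemma A2 over windows (Abel summation against the prime number theorem with
  `k_d(x) + k_d(νx)`, sum versus integral);
* `Halasz.Restricted.norm_Sh_restr_mul_log_le`, `…_le_integral` — Lemmas A1/A2 for the restricted function over
  windows: `‖S_ν(x)‖ log x ≤ x ∫_{log 2}^{log x} ‖S_ν(e^u)‖e^{-u} du + (3|C|+10)x + 2L(ν-1)x + 2|E| log(νx)`;
* `Halasz.integral_normShExp_le` — GS03 (3.7) over windows (Fubini):
  `∫ ‖S_ν(e^u)‖e^{-u} ≤ 17 ∫_{α₀}^1 I_ν(α) dα + (ν-1)(log log x + 2)`,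
  `I_ν(α) = ∫ ‖A(νe^u) - A(e^u)‖ e^{-(1+2α)u} du`;
* `Halasz.Restricted.inner_integral_restr_interval_le` — GS03 (3.8) (Cauchy–Schwarz in `u`) with the interval
  mean square `meanSquare_mulLog_restr_interval_le` of part I:
  `I_ν(α) ≤ 2(ν-1)B/α + e^{12}(√G + |𝓙|√(8(ν-1)² log Q + G))/(α√α) + (32/√T₀ + 90/T₀)/√α + 47e⁵/(α²T₀)`,
  `G = 16 u₁ + 256`, for `‖𝒢_a‖ ≤ B ≤ e^{12}/α` on `|y| ≤ T₀`;
* `Halasz.Restricted.norm_restr_interval_sum_le` — the theorem, by the two-regime `α`-integration of the tree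
  (`B = min(e^{12}/α, B_w + 4αe⁵ log(νx)/T)` on `[α₀, α₁]`); the prime number theorem constant is instantiated
  from `ChebyshevThetaDeLaValleePoussin_holds.logPow 6` and hidden in `K` via `u₁ ≤ (1 + (3C)^{1/6})(ν-1)^{-1/6}`.

## References
* A. Granville, K. Soundararajan, *Decay of mean values of multiplicative functions*, Canad. J. Math. 55 (2003),
  Lemma 2.1, §3b ((3.7)–(3.8), Lemma 3.2), §4. [cite: GranvilleSoundararajan2003, Theorem 1]
* K. Matomäki, M. Radziwiłł, T. Tao, Algebra & Number Theory 9 (2015), Appendix A, Proposition A.3 (proof: the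
  ranges `𝒯₀ ∪ 𝒯₁`). [cite: MatomakiRadziwillTao2015, Appendix A, Proposition A.3 (proof)]

## Design choices
* The level of the smooth cut is `N = ⌊νx⌋` (so that `S_a(νx) - S_a(x) = ∑_{x < n ≤ νx} g(n) 1_𝒮(n)` exactly); the
  Euler-product lemmas of the tree are applied at the height `νx ∈ [3, 2x]`, the `u`-integrals run over
  `(log 2, log x]`.
* Index type `ℕ` in the final statement (as in `norm_restr_sum_le`); constants explicit, astronomically crude;
  `linarith only` throughout the long bookkeeping proof to keep elaboration cheap.
-/

noncomputable section

open Finset Real Complex MeasureTheory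
open scoped ArithmeticFunction.vonMangoldt Chebyshev

namespace Literature.NumberTheory.LFunctions

namespace Halasz

open MellinPlancherel (psum)

variable {g : ℕ → ℂ}

/-! ### Window sums `S(νy) - S(y)` -/

/-- The sum of `g` over the multiplicative window `(y, νy]`: `S_ν(y) = S(νy) - S(y)`. [folklore] -/
def Sh (g : ℕ → ℂ) (ν y : ℝ) : ℂ := S g (ν * y) - S g y

/-- `S_ν(y) = ∑_{⌊y⌋ < n ≤ ⌊νy⌋} g(n)` (`ν ≥ 1`, `y ≥ 0`). [folklore] -/
theorem Sh_eq_sum (g : ℕ → ℂ) {ν y : ℝ} (hν : 1 ≤ ν) (hy : 0 ≤ y) :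
    Sh g ν y = ∑ n ∈ Finset.Ioc ⌊y⌋₊ ⌊ν * y⌋₊, g n := by
  have hle : y ≤ ν * y := by nlinarith
  unfold Sh
  rw [S_eq_sum_Ioc, S_eq_sum_Ioc, ← Finset.sum_Ioc_consecutive _ (Nat.zero_le _) (Nat.floor_le_floor hle)]
  ring

/-- `‖S_ν(y)‖ ≤ ⌊νy⌋ - ⌊y⌋` for `1`-bounded `g` (`ν ≥ 1`, `y ≥ 0`). [folklore] -/
theorem norm_Sh_le (hgb : ∀ n, ‖g n‖ ≤ 1) {ν y : ℝ} (hν : 1 ≤ ν) (hy : 0 ≤ y) :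
    ‖Sh g ν y‖ ≤ (⌊ν * y⌋₊ : ℝ) - ⌊y⌋₊ := by
  have hle : y ≤ ν * y := by nlinarith
  exact norm_S_sub_S_le hgb (Nat.floor_le_floor hle)

/-- `⌊νy⌋ - ⌊y⌋ ≤ (ν - 1) y + 1` (`y ≥ 0`). [folklore] -/
theorem floor_sub_floor_le {ν y : ℝ} (hν : 1 ≤ ν) (hy : 0 ≤ y) :
    (⌊ν * y⌋₊ : ℝ) - ⌊y⌋₊ ≤ (ν - 1) * y + 1 := by
  have h1 : (⌊ν * y⌋₊ : ℝ) ≤ ν * y := Nat.floor_le (by nlinarith)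
  have h2 : y < (⌊y⌋₊ : ℝ) + 1 := Nat.lt_floor_add_one y
  nlinarith

/-- `‖S_ν(y)‖ ≤ (ν - 1) y + 1`. [folklore] -/
theorem norm_Sh_le' (hgb : ∀ n, ‖g n‖ ≤ 1) {ν y : ℝ} (hν : 1 ≤ ν) (hy : 0 ≤ y) :
    ‖Sh g ν y‖ ≤ (ν - 1) * y + 1 :=
  (norm_Sh_le hgb hν hy).trans (floor_sub_floor_le hν hy)

/-- `S_ν(y) = 0` for `νy < 1`. [folklore] -/
theorem Sh_of_lt_one (g : ℕ → ℂ) {ν y : ℝ} (hν : 1 ≤ ν) (hy : ν * y < 1) : Sh g ν y = 0 := by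
  unfold Sh
  rcases lt_or_ge y 0 with h | h
  · rw [S_of_lt_one g (by nlinarith : ν * y < 1), S_of_lt_one g (by linarith)]; simp
  · rw [S_of_lt_one g hy, S_of_lt_one g (by nlinarith)]; simp

/-- The log-scale integrand `‖S_ν(e^u)‖ e^{-u}`. [folklore] -/
def normShExp (g : ℕ → ℂ) (ν u : ℝ) : ℝ := ‖Sh g ν (Real.exp u)‖ * Real.exp (-u)

/-- `u ↦ ‖S_ν(e^u)‖ e^{-u}` is measurable. [folklore] -/
theorem measurable_normShExp (g : ℕ → ℂ) (ν : ℝ) : Measurable (normShExp g ν) := by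
  unfold normShExp Sh
  refine Measurable.mul ?_ (Real.measurable_exp.comp measurable_neg)
  exact (((measurable_S g).comp (Real.measurable_exp.const_mul ν)).sub
    ((measurable_S g).comp Real.measurable_exp)).norm

/-- `0 ≤ ‖S_ν(e^u)‖ e^{-u}`. [folklore] -/
theorem normShExp_nonneg (g : ℕ → ℂ) (ν u : ℝ) : 0 ≤ normShExp g ν u := by unfold normShExp; positivity

/-- `‖S_ν(e^u)‖ e^{-u} ≤ (ν - 1) + e^{-u} ≤ ν` for `1`-bounded `g`, `ν ≥ 1`. [folklore] -/
theorem normShExp_le (hgb : ∀ n, ‖g n‖ ≤ 1) {ν : ℝ} (hν : 1 ≤ ν) (u : ℝ) :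
    normShExp g ν u ≤ (ν - 1) + Real.exp (-u) := by
  unfold normShExp
  have h := norm_Sh_le' hgb hν (Real.exp_pos u).le
  calc ‖Sh g ν (Real.exp u)‖ * Real.exp (-u) ≤ ((ν - 1) * Real.exp u + 1) * Real.exp (-u) := by gcongr
    _ = (ν - 1) + Real.exp (-u) := by
        rw [add_mul, mul_assoc, ← Real.exp_add, add_neg_cancel, Real.exp_zero, mul_one, one_mul]

/-- `u ↦ ‖S_ν(e^u)‖ e^{-u}` is interval integrable (bounded measurable). [folklore] -/
theorem intervalIntegrable_normShExp (hgb : ∀ n, ‖g n‖ ≤ 1) {ν : ℝ} (hν : 1 ≤ ν) (a b : ℝ) :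
    IntervalIntegrable (normShExp g ν) volume a b := by
  refine IntervalIntegrable.mono_fun' (g := fun u => (ν - 1) + Real.exp (-u))
    ((by fun_prop : Continuous fun u : ℝ => (ν - 1) + Real.exp (-u)).intervalIntegrable _ _)
    (measurable_normShExp g ν).aestronglyMeasurable (Filter.Eventually.of_forall fun u => ?_)
  show ‖normShExp g ν u‖ ≤ ν - 1 + Real.exp (-u)
  rw [Real.norm_of_nonneg (normShExp_nonneg g ν u)]
  exact normShExp_le hgb hν u

/-! ### Lemma A1, signed form, for windows -/

/-- **(A1) for windows, signed form**: for `1`-bounded `g`, `y ≥ 1`, `ν ≥ 1`,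
`‖S_ν(y)‖ log y ≤ ‖∑_{⌊y⌋ < n ≤ ⌊νy⌋} g(n) log n‖ + (⌊νy⌋ - ⌊y⌋) log ν`
(`log n = log y + log(n/y)` with `0 ≤ log(n/y) ≤ log ν` on the window). [folklore] -/
theorem norm_Sh_mul_log_le_norm_sum (hgb : ∀ n, ‖g n‖ ≤ 1) {ν y : ℝ} (hν : 1 ≤ ν) (hy : 1 ≤ y) :
    ‖Sh g ν y‖ * Real.log y ≤ ‖∑ n ∈ Finset.Ioc ⌊y⌋₊ ⌊ν * y⌋₊, g n * (Real.log n : ℂ)‖ +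
      ((⌊ν * y⌋₊ : ℝ) - ⌊y⌋₊) * Real.log ν := by
  have hy0 : 0 < y := by linarith
  have hν0 : 0 < ν := by linarith
  rw [Sh_eq_sum g hν hy0.le]
  have hdec : (∑ n ∈ Finset.Ioc ⌊y⌋₊ ⌊ν * y⌋₊, g n) * (Real.log y : ℂ) =
      ∑ n ∈ Finset.Ioc ⌊y⌋₊ ⌊ν * y⌋₊, g n * (Real.log n : ℂ) -
        ∑ n ∈ Finset.Ioc ⌊y⌋₊ ⌊ν * y⌋₊, g n * (Real.log (n / y) : ℂ) := by
    rw [Finset.sum_mul, ← Finset.sum_sub_distrib]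
    refine Finset.sum_congr rfl fun n hn => ?_
    rw [Finset.mem_Ioc] at hn
    have hn0 : (0 : ℝ) < n := by exact_mod_cast (show 0 < n by omega)
    rw [← mul_sub, ← Complex.ofReal_sub, Real.log_div hn0.ne' hy0.ne']
    ring_nf
  have hnorm : ‖∑ n ∈ Finset.Ioc ⌊y⌋₊ ⌊ν * y⌋₊, g n‖ * Real.log y =
      ‖(∑ n ∈ Finset.Ioc ⌊y⌋₊ ⌊ν * y⌋₊, g n) * (Real.log y : ℂ)‖ := by
    rw [norm_mul, Complex.norm_real, Real.norm_of_nonneg (Real.log_nonneg hy)]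
  rw [hnorm, hdec]
  refine (norm_sub_le _ _).trans (add_le_add le_rfl ?_)
  refine (norm_sum_le _ _).trans ?_
  have hterm : ∀ n ∈ Finset.Ioc ⌊y⌋₊ ⌊ν * y⌋₊, ‖g n * (Real.log (n / y) : ℂ)‖ ≤ Real.log ν := by
    intro n hn
    rw [Finset.mem_Ioc] at hn
    have hyn : y < n := by
      have := Nat.lt_of_floor_lt hn.1
      exact_mod_cast this
    have hn0 : (0 : ℝ) < n := by linarith
    have hnν : (n : ℝ) ≤ ν * y := (Nat.cast_le.2 hn.2).trans (Nat.floor_le (by positivity))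
    have h1 : 1 ≤ (n : ℝ) / y := by rw [le_div_iff₀ hy0]; linarith
    have h2 : (n : ℝ) / y ≤ ν := by rw [div_le_iff₀ hy0]; linarith
    have hlog0 : 0 ≤ Real.log (n / y) := Real.log_nonneg h1
    have hlogν : Real.log (n / y) ≤ Real.log ν := Real.log_le_log (by positivity) h2
    rw [norm_mul, Complex.norm_real, Real.norm_of_nonneg hlog0]
    calc ‖g n‖ * Real.log (n / y) ≤ 1 * Real.log (n / y) := mul_le_mul_of_nonneg_right (hgb n) hlog0
      _ ≤ Real.log ν := by rw [one_mul]; exact hlogν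
  calc ∑ n ∈ Finset.Ioc ⌊y⌋₊ ⌊ν * y⌋₊, ‖g n * (Real.log (n / y) : ℂ)‖
      ≤ ∑ n ∈ Finset.Ioc ⌊y⌋₊ ⌊ν * y⌋₊, Real.log ν := Finset.sum_le_sum hterm
    _ = ((⌊ν * y⌋₊ - ⌊y⌋₊ : ℕ) : ℝ) * Real.log ν := by
        rw [Finset.sum_const, Nat.card_Ioc, nsmul_eq_mul]
    _ = ((⌊ν * y⌋₊ : ℝ) - ⌊y⌋₊) * Real.log ν := by
        have hle : ⌊y⌋₊ ≤ ⌊ν * y⌋₊ := Nat.floor_le_floor (by nlinarith)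
        rw [Nat.cast_sub hle]

/-! ### Lemma A2 for windows: Abel summation and the integral -/

variable {x : ℝ}

/-- `|‖S_ν(x/d)‖ - ‖S_ν(x/(d+1))‖| ≤ k_d(x) + k_d(νx)`. [folklore] -/
theorem abs_norm_Sh_sub_le (hgb : ∀ n, ‖g n‖ ≤ 1) (hx : 0 ≤ x) {ν : ℝ} (hν : 1 ≤ ν) {d : ℕ} (hd : 1 ≤ d) :
    |‖Sh g ν (x / d)‖ - ‖Sh g ν (x / (d + 1))‖| ≤ kk x d + kk (ν * x) d := by
  have hνx : 0 ≤ ν * x := by nlinarith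
  have h1 := norm_S_sub_S_le hgb (floor_div_succ_le hx hd)
  have h2 := norm_S_sub_S_le hgb (floor_div_succ_le hνx hd)
  have htri := abs_norm_sub_norm_le (Sh g ν (x / d)) (Sh g ν (x / (d + 1)))
  have hsplit : Sh g ν (x / d) - Sh g ν (x / (d + 1)) =
      (S g (ν * x / d) - S g (ν * x / (d + 1))) - (S g (x / d) - S g (x / (d + 1))) := by
    unfold Sh; rw [mul_div_assoc, mul_div_assoc]; ring
  have hn : ‖Sh g ν (x / d) - Sh g ν (x / (d + 1))‖ ≤ kk (ν * x) d + kk x d := by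
    rw [hsplit]
    refine (norm_sub_le _ _).trans (add_le_add ?_ ?_)
    · unfold kk; exact h2
    · unfold kk; exact h1
  linarith

/-- **Abel summation against the prime number theorem, for windows**: with `a_d = ‖S_ν(x/d)‖`,
`∑_{d ≤ νx} Λ(d) a_d ≤ ∑_{d ≤ νx} a_d + ∑_{d ≤ νx} |ψ(d) - d| (k_d(x) + k_d(νx))`.
[cite: GranvilleSoundararajan2003, proof of Lemma 2.1] -/
theorem sum_vonMangoldt_mul_Sh_le (hgb : ∀ n, ‖g n‖ ≤ 1) (hx : 0 ≤ x) {ν : ℝ} (hν : 1 ≤ ν) :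
    ∑ d ∈ Finset.Icc 1 ⌊ν * x⌋₊, Λ d * ‖Sh g ν (x / d)‖ ≤
      ∑ d ∈ Finset.Icc 1 ⌊ν * x⌋₊, ‖Sh g ν (x / d)‖ +
        ∑ d ∈ Finset.Icc 1 ⌊ν * x⌋₊, |Chebyshev.psi d - d| * (kk x d + kk (ν * x) d) := by
  set Y := ⌊ν * x⌋₊ with hY
  set a : ℕ → ℝ := fun d => ‖Sh g ν (x / d)‖ with ha
  have hx0 : 0 ≤ x := hx
  have hνx0 : 0 ≤ ν * x := by nlinarith
  have haY : a (Y + 1) = 0 := by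
    simp only [ha]
    rw [Sh_of_lt_one g hν, norm_zero]
    rw [← mul_div_assoc, div_lt_one (by positivity), hY]
    exact_mod_cast Nat.lt_floor_add_one (ν * x)
  have h1 := abel_sum (fun d : ℕ => Chebyshev.psi d) a Y
  have h2 := abel_sum (fun d : ℕ => (d : ℝ)) a Y
  simp only [Nat.cast_zero, Chebyshev.psi_zero, zero_mul, sub_zero, haY, mul_zero, add_zero] at h1 h2
  have h1' : ∑ d ∈ Finset.Icc 1 Y, Λ d * a d =
      ∑ d ∈ Finset.Icc 1 Y, Chebyshev.psi d * (a d - a (d + 1)) := by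
    rw [← h1]
    refine Finset.sum_congr rfl fun d hd => ?_
    rw [Finset.mem_Icc] at hd
    rw [psi_sub_psi_pred hd.1]
  have h2' : ∑ d ∈ Finset.Icc 1 Y, a d = ∑ d ∈ Finset.Icc 1 Y, (d : ℝ) * (a d - a (d + 1)) := by
    rw [← h2]
    refine Finset.sum_congr rfl fun d hd => ?_
    rw [Finset.mem_Icc] at hd
    rw [Nat.cast_sub hd.1]; push_cast; ring
  rw [h1', h2', ← Finset.sum_add_distrib]
  refine Finset.sum_le_sum fun d hd => ?_
  rw [Finset.mem_Icc] at hd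
  have hk := abs_norm_Sh_sub_le hgb hx0 hν hd.1
  have : (Chebyshev.psi d - d) * (a d - a (d + 1)) ≤ |Chebyshev.psi d - d| * (kk x d + kk (ν * x) d) := by
    calc (Chebyshev.psi d - d) * (a d - a (d + 1)) ≤ |(Chebyshev.psi d - d) * (a d - a (d + 1))| := le_abs_self _
      _ = |Chebyshev.psi d - d| * |a d - a (d + 1)| := abs_mul _ _
      _ ≤ |Chebyshev.psi d - d| * (kk x d + kk (ν * x) d) := by
          gcongr
          simpa [ha] using hk
  linarith

/-- `k_d(x) = 0` for `d > ⌊x⌋`. [folklore] -/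
theorem kk_eq_zero_of_floor_lt {d : ℕ} (hd : ⌊x⌋₊ < d) : kk x d = 0 := by
  unfold kk
  have hd0 : (0 : ℝ) < d := by exact_mod_cast (show 0 < d by omega)
  have hxd : x < d := Nat.lt_of_floor_lt hd
  have h1 : ⌊x / d⌋₊ = 0 := by
    rw [Nat.floor_eq_zero, div_lt_one hd0]; exact hxd
  have h2 : ⌊x / (d + 1)⌋₊ = 0 := by
    rw [Nat.floor_eq_zero, div_lt_one (by linarith)]; linarith
  rw [h1, h2]; simp

/-- **The error term for windows**: if `∑_{d ≤ z} |ψ(d) - d| k_d(z) ≤ C_E z` for `z ≥ 3` then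
`∑_{d ≤ νx} |ψ(d) - d| (k_d(x) + k_d(νx)) ≤ C_E (x + νx)` for `x ≥ 3`, `ν ≥ 1`. [folklore] -/
theorem sum_abs_psi_sub_mul_kk_window_le {C : ℝ}
    (hC : ∀ z : ℝ, 3 ≤ z → ∑ d ∈ Finset.Icc 1 ⌊z⌋₊, |Chebyshev.psi d - d| * kk z d ≤ C * z)
    (hx : 3 ≤ x) {ν : ℝ} (hν : 1 ≤ ν) :
    ∑ d ∈ Finset.Icc 1 ⌊ν * x⌋₊, |Chebyshev.psi d - d| * (kk x d + kk (ν * x) d) ≤ C * (x + ν * x) := by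
  have hx0 : 0 ≤ x := by linarith
  have hνx : 3 ≤ ν * x := by nlinarith
  have hfl : ⌊x⌋₊ ≤ ⌊ν * x⌋₊ := Nat.floor_le_floor (by nlinarith)
  have hsplit : ∑ d ∈ Finset.Icc 1 ⌊ν * x⌋₊, |Chebyshev.psi d - d| * (kk x d + kk (ν * x) d) =
      ∑ d ∈ Finset.Icc 1 ⌊ν * x⌋₊, |Chebyshev.psi d - d| * kk x d +
        ∑ d ∈ Finset.Icc 1 ⌊ν * x⌋₊, |Chebyshev.psi d - d| * kk (ν * x) d := by
    rw [← Finset.sum_add_distrib]; exact Finset.sum_congr rfl fun d _ => by ring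
  have hfirst : ∑ d ∈ Finset.Icc 1 ⌊ν * x⌋₊, |Chebyshev.psi d - d| * kk x d =
      ∑ d ∈ Finset.Icc 1 ⌊x⌋₊, |Chebyshev.psi d - d| * kk x d := by
    have hsub : Finset.Icc 1 ⌊x⌋₊ ⊆ Finset.Icc 1 ⌊ν * x⌋₊ := Finset.Icc_subset_Icc le_rfl hfl
    rw [← Finset.sum_subset hsub]
    intro d hd hd'
    rw [Finset.mem_Icc] at hd hd'
    have : ⌊x⌋₊ < d := by omega
    rw [kk_eq_zero_of_floor_lt this, mul_zero]
  rw [hsplit, hfirst]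
  have h1 := hC x hx
  have h2 := hC (ν * x) hνx
  linarith

/-- The per-`d` inequality for windows: for `1 ≤ d` and `x > 0`,
`‖S_ν(x/d)‖ - (k_d(x) + k_d(νx)) ≤ x ∫_{log(x/(d+1))}^{log(x/d)} ‖S_ν(e^u)‖ e^{-u} du`. [folklore] -/
theorem norm_Sh_div_sub_le (hgb : ∀ n, ‖g n‖ ≤ 1) (hx : 0 < x) {ν : ℝ} (hν : 1 ≤ ν) {d : ℕ} (hd : 1 ≤ d) :
    ‖Sh g ν (x / d)‖ - (kk x d + kk (ν * x) d) ≤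
      x * ∫ u in Real.log (x / (d + 1))..Real.log (x / d), normShExp g ν u := by
  have hd0 : (0 : ℝ) < d := by exact_mod_cast hd
  have hν0 : 0 < ν := by linarith
  set α := Real.log (x / (d + 1)) with hα
  set β := Real.log (x / d) with hβ
  have hxd1 : 0 < x / (d + 1) := by positivity
  have hxd : 0 < x / d := by positivity
  have hle : x / (d + 1) ≤ x / d := div_le_div_of_nonneg_left hx.le hd0 (by linarith)
  have hαβ : α ≤ β := Real.log_le_log hxd1 hle
  -- pointwise lower bound on `[α, β]`
  have hpt : ∀ u ∈ Set.Icc α β, (‖Sh g ν (x / d)‖ - (kk x d + kk (ν * x) d)) * Real.exp (-u) ≤ normShExp g ν u := by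
    intro u hu
    unfold normShExp
    refine mul_le_mul_of_nonneg_right ?_ (Real.exp_pos _).le
    have hu1 : x / (d + 1) ≤ Real.exp u := by
      calc x / (d + 1) = Real.exp α := (Real.exp_log hxd1).symm
        _ ≤ Real.exp u := Real.exp_le_exp.mpr hu.1
    have hu2 : Real.exp u ≤ x / d := by
      calc Real.exp u ≤ Real.exp β := Real.exp_le_exp.mpr hu.2
        _ = x / d := Real.exp_log hxd
    have hfl1 : ⌊x / (d + 1)⌋₊ ≤ ⌊Real.exp u⌋₊ := Nat.floor_le_floor hu1
    have hfl2 : ⌊Real.exp u⌋₊ ≤ ⌊x / d⌋₊ := Nat.floor_le_floor hu2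
    have hfl1' : ⌊ν * x / (d + 1)⌋₊ ≤ ⌊ν * Real.exp u⌋₊ := by
      refine Nat.floor_le_floor ?_; rw [mul_div_assoc]; exact mul_le_mul_of_nonneg_left hu1 hν0.le
    have hfl2' : ⌊ν * Real.exp u⌋₊ ≤ ⌊ν * x / d⌋₊ := by
      refine Nat.floor_le_floor ?_; rw [mul_div_assoc]; exact mul_le_mul_of_nonneg_left hu2 hν0.le
    have hsubS := norm_S_sub_S_le hgb hfl2
    have hsubS' := norm_S_sub_S_le hgb hfl2'
    have hdiff : Sh g ν (x / d) - Sh g ν (Real.exp u) =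
        (S g (ν * x / d) - S g (ν * Real.exp u)) - (S g (x / d) - S g (Real.exp u)) := by
      unfold Sh; rw [mul_div_assoc]; ring
    have htri : ‖Sh g ν (x / d)‖ ≤ ‖Sh g ν (Real.exp u)‖ + ‖Sh g ν (x / d) - Sh g ν (Real.exp u)‖ := by
      have := norm_add_le (Sh g ν (Real.exp u)) (Sh g ν (x / d) - Sh g ν (Real.exp u))
      rwa [add_sub_cancel] at this
    have hn : ‖Sh g ν (x / d) - Sh g ν (Real.exp u)‖ ≤
        ((⌊ν * x / d⌋₊ : ℝ) - ⌊ν * Real.exp u⌋₊) + ((⌊x / d⌋₊ : ℝ) - ⌊Real.exp u⌋₊) := by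
      rw [hdiff]; exact (norm_sub_le _ _).trans (add_le_add hsubS' hsubS)
    have hk : ((⌊x / d⌋₊ : ℝ) - ⌊Real.exp u⌋₊) ≤ kk x d := by
      unfold kk
      have : (⌊x / (d + 1)⌋₊ : ℝ) ≤ ⌊Real.exp u⌋₊ := by exact_mod_cast hfl1
      linarith
    have hk' : ((⌊ν * x / d⌋₊ : ℝ) - ⌊ν * Real.exp u⌋₊) ≤ kk (ν * x) d := by
      unfold kk
      have : (⌊ν * x / (d + 1)⌋₊ : ℝ) ≤ ⌊ν * Real.exp u⌋₊ := by exact_mod_cast hfl1'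
      linarith
    linarith
  -- integrate
  have hI : ∫ u in α..β, (‖Sh g ν (x / d)‖ - (kk x d + kk (ν * x) d)) * Real.exp (-u) =
      (‖Sh g ν (x / d)‖ - (kk x d + kk (ν * x) d)) * ((d + 1) / x - d / x) := by
    rw [intervalIntegral.integral_const_mul]
    congr 1
    rw [intervalIntegral.integral_comp_neg (fun u => Real.exp u), integral_exp]
    rw [hα, hβ, Real.exp_neg, Real.exp_neg, Real.exp_log hxd1, Real.exp_log hxd, inv_div, inv_div]
  have hmono : ∫ u in α..β, (‖Sh g ν (x / d)‖ - (kk x d + kk (ν * x) d)) * Real.exp (-u) ≤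
      ∫ u in α..β, normShExp g ν u :=
    intervalIntegral.integral_mono_on hαβ ((continuous_const.mul (by fun_prop)).intervalIntegrable _ _)
      (intervalIntegrable_normShExp hgb hν _ _) hpt
  rw [hI] at hmono
  have hx1 : (‖Sh g ν (x / d)‖ - (kk x d + kk (ν * x) d)) * ((d + 1) / x - d / x) =
      (‖Sh g ν (x / d)‖ - (kk x d + kk (ν * x) d)) / x := by
    field_simp; ring
  rw [hx1, div_le_iff₀ hx] at hmono
  linarith

/-- **Sum versus integral for windows**:
`∑_{d ≤ x} ‖S_ν(x/d)‖ ≤ x ∫_0^{log x} ‖S_ν(e^u)‖ e^{-u} du + ⌊x⌋ + ⌊νx⌋ + 2` (`x ≥ 1`, `1 ≤ ν ≤ 2`). [folklore] -/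
theorem sum_norm_Sh_div_le (hgb : ∀ n, ‖g n‖ ≤ 1) (hx : 1 ≤ x) {ν : ℝ} (hν : 1 ≤ ν) (hν2 : ν ≤ 2) :
    ∑ d ∈ Finset.Icc 1 ⌊x⌋₊, ‖Sh g ν (x / d)‖ ≤
      x * (∫ u in (0:ℝ)..Real.log x, normShExp g ν u) + ⌊x⌋₊ + ⌊ν * x⌋₊ + 2 := by
  have hx0 : 0 < x := by linarith
  set Y := ⌊x⌋₊ with hY
  have hY1 : 1 ≤ Y := Nat.le_floor (by simpa using hx)
  -- the break points `e k = log(x/(Y+1-k))`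
  set e : ℕ → ℝ := fun k => Real.log (x / ((Y + 1 - k : ℕ) : ℝ)) with he
  have he0 : e 0 = Real.log (x / (Y + 1)) := by simp [he]
  have heY : e Y = Real.log x := by
    simp only [he]; rw [show Y + 1 - Y = 1 by omega]; simp
  -- per-`k` inequality
  have hk : ∀ k ∈ Finset.range Y,
      ‖Sh g ν (x / (Y - k : ℕ))‖ - (kk x (Y - k) + kk (ν * x) (Y - k)) ≤ x * ∫ u in e k..e (k + 1), normShExp g ν u := by
    intro k hkY
    rw [Finset.mem_range] at hkY
    have h := norm_Sh_div_sub_le hgb hx0 hν (d := Y - k) (by omega)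
    have h1 : Real.log (x / (((Y - k : ℕ) : ℝ) + 1)) = e k := by
      simp only [he]; congr 2; rw [show Y + 1 - k = (Y - k) + 1 by omega]; push_cast; ring
    have h2 : Real.log (x / ((Y - k : ℕ) : ℝ)) = e (k + 1) := by
      simp only [he]; congr 2; rw [show Y + 1 - (k + 1) = Y - k by omega]
    rw [h1, h2] at h
    exact h
  have hsum := Finset.sum_le_sum hk
  rw [← Finset.mul_sum, intervalIntegral.sum_integral_adjacent_intervals
    (fun k _ => intervalIntegrable_normShExp hgb hν _ _), he0, heY] at hsum
  -- reindex the left-hand side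
  have hreindex : ∑ k ∈ Finset.range Y, (‖Sh g ν (x / (Y - k : ℕ))‖ - (kk x (Y - k) + kk (ν * x) (Y - k))) =
      ∑ d ∈ Finset.Icc 1 Y, (‖Sh g ν (x / d)‖ - (kk x d + kk (ν * x) d)) := by
    have h1 := Finset.sum_range_reflect (fun k => ‖Sh g ν (x / ((k + 1 : ℕ) : ℝ))‖ -
      (kk x (k + 1) + kk (ν * x) (k + 1))) Y
    have h2 : ∀ k ∈ Finset.range Y, (‖Sh g ν (x / (((Y - 1 - k) + 1 : ℕ) : ℝ))‖ -
        (kk x ((Y - 1 - k) + 1) + kk (ν * x) ((Y - 1 - k) + 1))) =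
        (‖Sh g ν (x / (Y - k : ℕ))‖ - (kk x (Y - k) + kk (ν * x) (Y - k))) := by
      intro k hkY
      rw [Finset.mem_range] at hkY
      rw [show Y - 1 - k + 1 = Y - k by omega]
    rw [← Finset.sum_congr rfl h2, h1, show Finset.Icc 1 Y = Finset.Ico 1 (1 + Y) by
      ext d; simp only [Finset.mem_Icc, Finset.mem_Ico]; omega, Finset.sum_Ico_eq_sum_range,
      Nat.add_sub_cancel_left]
    refine Finset.sum_congr rfl fun k _ => ?_
    rw [add_comm 1 k]
  rw [hreindex, Finset.sum_sub_distrib, Finset.sum_add_distrib, sum_kk_eq Y hY] at hsum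
  -- the `kk (νx)` telescoping sum
  have hkkν : ∑ d ∈ Finset.Icc 1 Y, kk (ν * x) d ≤ ⌊ν * x⌋₊ := by
    have hνx0 : 0 ≤ ν * x := by nlinarith
    calc ∑ d ∈ Finset.Icc 1 Y, kk (ν * x) d ≤ ∑ d ∈ Finset.Icc 1 ⌊ν * x⌋₊, kk (ν * x) d :=
          Finset.sum_le_sum_of_subset_of_nonneg (Finset.Icc_subset_Icc le_rfl (Nat.floor_le_floor (by nlinarith)))
            (fun d hd _ => kk_nonneg hνx0 (by rw [Finset.mem_Icc] at hd; exact hd.1))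
      _ = ⌊ν * x⌋₊ := sum_kk_eq _ rfl
  -- split the integral at `0`
  have hsplit : ∫ u in Real.log (x / (Y + 1))..Real.log x, normShExp g ν u =
      (∫ u in Real.log (x / (Y + 1))..0, normShExp g ν u) + ∫ u in (0:ℝ)..Real.log x, normShExp g ν u :=
    (intervalIntegral.integral_add_adjacent_intervals (intervalIntegrable_normShExp hgb hν _ _)
      (intervalIntegrable_normShExp hgb hν _ _)).symm
  have hneg : Real.log (x / (Y + 1)) ≤ 0 := by
    apply Real.log_nonpos (by positivity)
    rw [div_le_one (by positivity), hY]
    exact (Nat.lt_floor_add_one x).le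
  have hsmall : x * ∫ u in Real.log (x / (Y + 1))..0, normShExp g ν u ≤ 2 := by
    have hbd : ∀ u ∈ Set.Icc (Real.log (x / (Y + 1))) 0, normShExp g ν u ≤ 2 * Real.exp (-u) := by
      intro u hu
      have h := normShExp_le hgb hν u
      have h1 : (1 : ℝ) ≤ Real.exp (-u) := by simpa using Real.one_le_exp (by linarith [hu.2] : 0 ≤ -u)
      linarith
    have hI : ∫ u in Real.log (x / (Y + 1))..0, normShExp g ν u ≤ ∫ u in Real.log (x / (Y + 1))..0, 2 * Real.exp (-u) :=
      intervalIntegral.integral_mono_on hneg (intervalIntegrable_normShExp hgb hν _ _)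
        ((by fun_prop : Continuous fun u : ℝ => 2 * Real.exp (-u)).intervalIntegrable _ _) hbd
    have hval : ∫ u in Real.log (x / (Y + 1))..0, 2 * Real.exp (-u) = 2 * ((Y + 1) / x - 1) := by
      rw [intervalIntegral.integral_const_mul, intervalIntegral.integral_comp_neg (fun u => Real.exp u),
        integral_exp, neg_zero, Real.exp_zero, Real.exp_neg, Real.exp_log (by positivity), inv_div]
    rw [hval] at hI
    have hYx : (Y : ℝ) ≤ x := Nat.floor_le hx0.le
    calc x * ∫ u in Real.log (x / (Y + 1))..0, normShExp g ν u ≤ x * (2 * ((Y + 1) / x - 1)) :=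
          mul_le_mul_of_nonneg_left hI hx0.le
      _ = 2 * (Y + 1 - x) := by field_simp
      _ ≤ 2 := by linarith
  rw [hsplit, mul_add] at hsum
  have hkkν' := hkkν
  linarith

/-- The windows beyond `x`: `∑_{⌊x⌋ < d ≤ ⌊νx⌋} ‖S_ν(x/d)‖ ≤ 2 ((ν - 1) x + 1)` (`1 ≤ ν ≤ 2`, `x ≥ 1`;
there `x/d < 1`, so `S_ν(x/d) = S(νx/d)` has at most `⌊νx/d⌋ < 2` terms). [folklore] -/
theorem sum_norm_Sh_div_tail_le (hgb : ∀ n, ‖g n‖ ≤ 1) (hx : 1 ≤ x) {ν : ℝ} (hν : 1 ≤ ν) (hν2 : ν ≤ 2) :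
    ∑ d ∈ Finset.Ioc ⌊x⌋₊ ⌊ν * x⌋₊, ‖Sh g ν (x / d)‖ ≤ 2 * ((ν - 1) * x + 1) := by
  have hx0 : 0 < x := by linarith
  have hterm : ∀ d ∈ Finset.Ioc ⌊x⌋₊ ⌊ν * x⌋₊, ‖Sh g ν (x / d)‖ ≤ 2 := by
    intro d hd
    rw [Finset.mem_Ioc] at hd
    have hxd : x < d := Nat.lt_of_floor_lt hd.1
    have hd0 : (0 : ℝ) < d := by linarith
    refine (norm_Sh_le' hgb hν (by positivity)).trans ?_
    have : x / d ≤ 1 := by rw [div_le_one hd0]; linarith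
    nlinarith
  calc ∑ d ∈ Finset.Ioc ⌊x⌋₊ ⌊ν * x⌋₊, ‖Sh g ν (x / d)‖ ≤ ∑ d ∈ Finset.Ioc ⌊x⌋₊ ⌊ν * x⌋₊, (2 : ℝ) :=
        Finset.sum_le_sum hterm
    _ = ((⌊ν * x⌋₊ - ⌊x⌋₊ : ℕ) : ℝ) * 2 := by rw [Finset.sum_const, Nat.card_Ioc, nsmul_eq_mul]
    _ ≤ ((ν - 1) * x + 1) * 2 := by
        refine mul_le_mul_of_nonneg_right ?_ (by norm_num)
        have hle : ⌊x⌋₊ ≤ ⌊ν * x⌋₊ := Nat.floor_le_floor (by nlinarith)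
        rw [Nat.cast_sub hle]
        exact floor_sub_floor_le hν hx0.le
    _ = 2 * ((ν - 1) * x + 1) := by ring

/-- `∫_0^{log 2} ‖S_ν(e^u)‖ e^{-u} du ≤ 2`. [folklore] -/
theorem integral_normShExp_small_le (hgb : ∀ n, ‖g n‖ ≤ 1) {ν : ℝ} (hν : 1 ≤ ν) (hν2 : ν ≤ 2) :
    ∫ u in (0:ℝ)..Real.log 2, normShExp g ν u ≤ 2 := by
  have hlog2 : 0 ≤ Real.log 2 := Real.log_nonneg (by norm_num)
  have hlog2' : Real.log 2 ≤ 1 := by have := Real.log_two_lt_d9; linarith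
  calc ∫ u in (0:ℝ)..Real.log 2, normShExp g ν u ≤ ∫ u in (0:ℝ)..Real.log 2, (2 : ℝ) :=
        intervalIntegral.integral_mono_on hlog2 (intervalIntegrable_normShExp hgb hν _ _) intervalIntegrable_const
          (fun u hu => by
            have h := normShExp_le hgb hν u
            have : Real.exp (-u) ≤ 1 := by rw [Real.exp_le_one_iff]; linarith [hu.1]
            linarith)
    _ = 2 * Real.log 2 := by simp; ring
    _ ≤ 2 := by nlinarith

/-! ### Lemma A1 for the restricted function over windows -/

namespace Restricted

open ArithmeticFunction (vonMangoldt)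

variable {ι : Type*} {𝓙 : Finset ι} {blk : ι → Finset ℕ} {N : ℕ}

/-- `∑_{d ≤ Y, (d,E) ≠ 1} Λ(d) ≤ |E| log Y` for a set `E` of primes (`Y ≥ 1`). [folklore] -/
theorem sum_vonMangoldt_blocks_le_card_mul_log {E : Finset ℕ} (hE : ∀ p ∈ E, p.Prime) {Y : ℕ} (hY : 1 ≤ Y) :
    ∑ d ∈ (Finset.Icc 1 Y).filter (fun d => ∃ p ∈ E, p ∣ d), (vonMangoldt d : ℝ) ≤ E.card * Real.log Y := by
  classical
  calc ∑ d ∈ (Finset.Icc 1 Y).filter (fun d => ∃ p ∈ E, p ∣ d), (vonMangoldt d : ℝ)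
      ≤ ∑ d ∈ (Finset.Icc 1 Y).filter (fun d => ∃ p ∈ E, p ∣ d), ∑ p ∈ E, if p ∣ d then (vonMangoldt d : ℝ) else 0 := by
        refine Finset.sum_le_sum fun d hd => ?_
        obtain ⟨p₀, hp₀, hdvd⟩ := (Finset.mem_filter.mp hd).2
        calc (vonMangoldt d : ℝ) = if p₀ ∣ d then (vonMangoldt d : ℝ) else 0 := by rw [if_pos hdvd]
          _ ≤ ∑ p ∈ E, if p ∣ d then (vonMangoldt d : ℝ) else 0 :=
              Finset.single_le_sum (f := fun p => if p ∣ d then (vonMangoldt d : ℝ) else 0)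
                (fun p _ => by split_ifs <;> [exact ArithmeticFunction.vonMangoldt_nonneg; exact le_rfl]) hp₀
    _ ≤ ∑ d ∈ Finset.Icc 1 Y, ∑ p ∈ E, if p ∣ d then (vonMangoldt d : ℝ) else 0 :=
        Finset.sum_le_sum_of_subset_of_nonneg (Finset.filter_subset _ _) fun d _ _ =>
          Finset.sum_nonneg fun p _ => by
            split_ifs <;> [exact ArithmeticFunction.vonMangoldt_nonneg; exact le_rfl]
    _ = ∑ p ∈ E, ∑ d ∈ (Finset.Icc 1 Y).filter (p ∣ ·), (vonMangoldt d : ℝ) := by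
        rw [Finset.sum_comm]
        refine Finset.sum_congr rfl fun p _ => ?_
        rw [Finset.sum_filter]
    _ ≤ ∑ p ∈ E, Real.log Y := Finset.sum_le_sum fun p hp => sum_vonMangoldt_filter_dvd_le (hE p hp) hY
    _ = E.card * Real.log Y := by rw [Finset.sum_const, nsmul_eq_mul]

/-- The window log-sum as a double sum: for `y ≤ z`,
`∑_{⌊y⌋ < n ≤ ⌊z⌋} a(n) log n = ∑_{d ≤ ⌊z⌋} ∑_{⌊y⌋/d < m ≤ ⌊z⌋/d} Λ(d) a(dm)`. [folklore] -/
theorem window_logsum_eq (a : ℕ → ℂ) {y z : ℝ} (hyz : y ≤ z) :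
    ∑ n ∈ Finset.Ioc ⌊y⌋₊ ⌊z⌋₊, a n * (Real.log n : ℂ) =
      ∑ d ∈ Finset.Icc 1 ⌊z⌋₊, ∑ m ∈ Finset.Ioc (⌊y⌋₊ / d) (⌊z⌋₊ / d), (vonMangoldt d : ℂ) * a (d * m) := by
  have hfl : ⌊y⌋₊ ≤ ⌊z⌋₊ := Nat.floor_le_floor hyz
  have e : ∀ n : ℕ, Finset.Icc 1 n = Finset.Ioc 0 n := fun n => by
    ext m; simp only [Finset.mem_Icc, Finset.mem_Ioc]; omega
  -- the window sum as a difference of two initial sums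
  have h1 : ∑ n ∈ Finset.Ioc ⌊y⌋₊ ⌊z⌋₊, a n * (Real.log n : ℂ) =
      ∑ n ∈ Finset.Icc 1 ⌊z⌋₊, a n * (Real.log n : ℂ) - ∑ n ∈ Finset.Icc 1 ⌊y⌋₊, a n * (Real.log n : ℂ) := by
    rw [e, e, ← Finset.sum_Ioc_consecutive _ (Nat.zero_le ⌊y⌋₊) hfl]; ring
  rw [h1, sum_mul_log_eq_sum_sum a z, sum_mul_log_eq_sum_sum a y]
  -- extend the `d`-range of the second double sum
  have h2 : ∑ d ∈ Finset.Icc 1 ⌊y⌋₊, ∑ m ∈ Finset.Icc 1 (⌊y⌋₊ / d), (vonMangoldt d : ℂ) * a (d * m) =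
      ∑ d ∈ Finset.Icc 1 ⌊z⌋₊, ∑ m ∈ Finset.Icc 1 (⌊y⌋₊ / d), (vonMangoldt d : ℂ) * a (d * m) := by
    refine Finset.sum_subset (Finset.Icc_subset_Icc le_rfl hfl) fun d hd hd' => ?_
    rw [Finset.mem_Icc] at hd hd'
    have : ⌊y⌋₊ / d = 0 := Nat.div_eq_of_lt (by omega)
    rw [this]; simp
  rw [h2, ← Finset.sum_sub_distrib]
  refine Finset.sum_congr rfl fun d hd => ?_
  rw [e, e, ← Finset.sum_Ioc_consecutive _ (Nat.zero_le (⌊y⌋₊ / d)) (Nat.div_le_div_right hfl)]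
  ring

/-- **Lemma A1 for the restricted function over windows**: for a block system, `g` completely
multiplicative with `|g| ≤ 1`, `∑_{p ∈ E} log p/p ≤ L`, `y ≥ 1` and `1 ≤ ν ≤ 2`, with `a = g̃ 1_𝒮` and
`S_ν(z) = S_a(νz) - S_a(z)`,
`‖S_ν(y)‖ log y ≤ ∑_{d ≤ νy} Λ(d) ‖S_ν(y/d)‖ + 2L(ν-1)y + 2|E| log(νy) + (ν-1)y + 1`
(for `d = p^k`, `p ∉ E`, `a(dm) = g̃(d) a(m)`; the `d` with `p ∈ E` are bounded crudely).
[cite: GranvilleSoundararajan2003, Lemma 2.1] -/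
theorem norm_Sh_restr_mul_log_le [DecidableEq ι] (h : IsBlockSystem 𝓙 blk N)
    (hg : ∀ m n, g (m * n) = g m * g n) (hgb : ∀ n, ‖g n‖ ≤ 1) {L : ℝ}
    (hL : ∑ p ∈ 𝓙.biUnion blk, Real.log p / p ≤ L) {ν : ℝ} (hν : 1 ≤ ν) (hν2 : ν ≤ 2) {y : ℝ} (hy : 1 ≤ y) :
    ‖Sh (restr 𝓙 blk g N) ν y‖ * Real.log y ≤
      ∑ d ∈ Finset.Icc 1 ⌊ν * y⌋₊, vonMangoldt d * ‖Sh (restr 𝓙 blk g N) ν (y / d)‖ +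
        2 * L * ((ν - 1) * y) + 2 * (𝓙.biUnion blk).card * Real.log (ν * y) + ((ν - 1) * y + 1) := by
  set a := restr 𝓙 blk g N with ha
  set E := 𝓙.biUnion blk with hE
  have hEprime : ∀ q ∈ E, q.Prime := fun q hq => h.prime_of_mem_biUnion (t := 𝓙) le_rfl hq
  have hblkprime : ∀ i ∈ 𝓙, ∀ q ∈ blk i, q.Prime := fun i hi q hq => h.prime_of_mem hi hq
  have hy0 : 0 < y := by linarith
  have hν0 : 0 < ν := by linarith
  have hνy1 : 1 ≤ ν * y := by nlinarith
  have hyνy : y ≤ ν * y := by nlinarith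
  have hab : ∀ n, ‖a n‖ ≤ 1 := norm_restr_le_one hgb
  set Y : ℕ := ⌊ν * y⌋₊ with hY
  have hY1 : 1 ≤ Y := Nat.le_floor (by simpa using hνy1)
  -- the inner sums
  set T : ℕ → ℂ := fun d => ∑ m ∈ Finset.Ioc (⌊y⌋₊ / d) (Y / d), (vonMangoldt d : ℂ) * a (d * m) with hT
  have hTle : ∀ d ∈ Finset.Icc 1 Y, ‖T d‖ ≤ vonMangoldt d * ‖Sh a ν (y / d)‖ +
      (if ∃ p ∈ E, p ∣ d then (vonMangoldt d : ℝ) / d * ((ν - 1) * y) + 2 * vonMangoldt d else 0) := by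
    intro d hd
    rw [Finset.mem_Icc] at hd
    have hd0 : (0 : ℝ) < d := by exact_mod_cast hd.1
    by_cases hΛ : (vonMangoldt d : ℝ) = 0
    · have : T d = 0 := Finset.sum_eq_zero fun m _ => by simp [hΛ]
      rw [this, norm_zero, hΛ]
      simp only [zero_mul, zero_div, mul_zero, add_zero, ite_self, le_refl]
    obtain ⟨p, k, hp, hk, rfl⟩ := exists_eq_pow_of_vonMangoldt_ne_zero hΛ
    by_cases hpE : p ∈ E
    · -- crude bound `≤ Λ(d) · #window`
      have hex : ∃ q ∈ E, q ∣ p ^ k := ⟨p, hpE, dvd_pow_self p hk.ne'⟩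
      rw [if_pos hex]
      have h1 : ‖T (p ^ k)‖ ≤ ∑ m ∈ Finset.Ioc (⌊y⌋₊ / p ^ k) (Y / p ^ k), (vonMangoldt (p ^ k) : ℝ) := by
        refine (norm_sum_le _ _).trans (Finset.sum_le_sum fun m _ => ?_)
        rw [norm_mul, Complex.norm_real, Real.norm_of_nonneg ArithmeticFunction.vonMangoldt_nonneg]
        exact mul_le_of_le_one_right ArithmeticFunction.vonMangoldt_nonneg (hab _)
      rw [Finset.sum_const, Nat.card_Ioc, nsmul_eq_mul] at h1
      -- `#window ≤ (ν-1) y/d + 2`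
      have hcount : (((Y / p ^ k - ⌊y⌋₊ / p ^ k : ℕ)) : ℝ) ≤ (ν - 1) * y / (p ^ k : ℕ) + 2 := by
        have hdpos : 0 < p ^ k := pow_pos hp.pos k
        have hA : ((Y / p ^ k : ℕ) : ℝ) ≤ ν * y / (p ^ k : ℕ) := by
          rw [le_div_iff₀ hd0]
          calc ((Y / p ^ k : ℕ) : ℝ) * ((p ^ k : ℕ) : ℝ) = (((Y / p ^ k) * p ^ k : ℕ) : ℝ) := by push_cast; ring
            _ ≤ (Y : ℝ) := by exact_mod_cast Nat.div_mul_le_self _ _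
            _ ≤ ν * y := Nat.floor_le (by positivity)
        have hB : y / (p ^ k : ℕ) - 2 ≤ ((⌊y⌋₊ / p ^ k : ℕ) : ℝ) := by
          have h2 := Nat.lt_div_mul_add (a := ⌊y⌋₊) hdpos
          have h3 : ((⌊y⌋₊ : ℕ) : ℝ) < ((⌊y⌋₊ / p ^ k : ℕ) : ℝ) * ((p ^ k : ℕ) : ℝ) + ((p ^ k : ℕ) : ℝ) := by
            exact_mod_cast h2
          have h4 : y < (⌊y⌋₊ : ℝ) + 1 := Nat.lt_floor_add_one y
          have h5 : 1 ≤ ((p ^ k : ℕ) : ℝ) := by exact_mod_cast hdpos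
          rw [sub_le_iff_le_add, div_le_iff₀ hd0]
          nlinarith
        have e : (ν - 1) * y / ((p ^ k : ℕ) : ℝ) = ν * y / ((p ^ k : ℕ) : ℝ) - y / ((p ^ k : ℕ) : ℝ) := by ring
        rcases le_or_gt (⌊y⌋₊ / p ^ k) (Y / p ^ k) with hle | hlt
        · rw [Nat.cast_sub hle]; linarith
        · rw [Nat.sub_eq_zero_of_le hlt.le]
          have : 0 ≤ (ν - 1) * y / ((p ^ k : ℕ) : ℝ) := by
            apply div_nonneg _ hd0.le; nlinarith
          push_cast at this ⊢
          linarith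
      have hΛ0 : 0 ≤ (vonMangoldt (p ^ k) : ℝ) := ArithmeticFunction.vonMangoldt_nonneg
      have hS0 : 0 ≤ vonMangoldt (p ^ k) * ‖Sh a ν (y / (p ^ k : ℕ))‖ := by positivity
      calc ‖T (p ^ k)‖ ≤ ((Y / p ^ k - ⌊y⌋₊ / p ^ k : ℕ) : ℝ) * vonMangoldt (p ^ k) := h1
        _ ≤ ((ν - 1) * y / (p ^ k : ℕ) + 2) * vonMangoldt (p ^ k) := mul_le_mul_of_nonneg_right hcount hΛ0
        _ = (vonMangoldt (p ^ k) : ℝ) / (p ^ k : ℕ) * ((ν - 1) * y) + 2 * vonMangoldt (p ^ k) := by ring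
        _ ≤ _ := le_add_of_nonneg_left hS0
    · -- exact factorisation `a(dm) = g̃(d) a(m)`
      have hpE' : ∀ i ∈ 𝓙, p ∉ blk i := fun i hi hpi => hpE (Finset.mem_biUnion.mpr ⟨i, hi, hpi⟩)
      have hfac : ∀ m : ℕ, a (p ^ k * m) = smoothCut g N (p ^ k) * a m := by
        intro m
        simp only [ha, restr]
        rw [smoothCut_mul hg, blockInd_primePow_mul hblkprime hp hpE' m]
        ring
      have hTeq : T (p ^ k) = (vonMangoldt (p ^ k) : ℂ) * smoothCut g N (p ^ k) * Sh a ν (y / (p ^ k : ℕ)) := by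
        simp only [hT]
        have hwin : Sh a ν (y / (p ^ k : ℕ)) = ∑ m ∈ Finset.Ioc (⌊y⌋₊ / p ^ k) (Y / p ^ k), a m := by
          rw [Sh_eq_sum a hν (by positivity), Nat.floor_div_natCast, mul_div_assoc', Nat.floor_div_natCast, hY]
        rw [hwin, Finset.mul_sum]
        exact Finset.sum_congr rfl fun m _ => by rw [hfac m]; ring
      have hnot : ¬ ∃ q ∈ E, q ∣ p ^ k := by
        rintro ⟨q, hq, hqd⟩
        exact hpE ((prime_dvd_primePow_iff hp (hEprime q hq) hk).mp hqd ▸ hq)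
      rw [if_neg hnot, add_zero, hTeq, norm_mul, norm_mul, Complex.norm_real,
        Real.norm_of_nonneg ArithmeticFunction.vonMangoldt_nonneg]
      calc vonMangoldt (p ^ k) * ‖smoothCut g N (p ^ k)‖ * ‖Sh a ν (y / (p ^ k : ℕ))‖
          ≤ vonMangoldt (p ^ k) * 1 * ‖Sh a ν (y / (p ^ k : ℕ))‖ := by
            gcongr
            exact norm_smoothCut_le hgb _
        _ = _ := by rw [mul_one]
  -- assemble
  have h0 := norm_Sh_mul_log_le_norm_sum hab hν hy
  rw [window_logsum_eq a hyνy] at h0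
  have hTsum : ∑ d ∈ Finset.Icc 1 Y, ∑ m ∈ Finset.Ioc (⌊y⌋₊ / d) (Y / d), (vonMangoldt d : ℂ) * a (d * m) =
      ∑ d ∈ Finset.Icc 1 Y, T d := rfl
  rw [← hY, hTsum] at h0
  have hLnn : 0 ≤ ∑ p ∈ E, Real.log p / p := Finset.sum_nonneg fun p hp => by
    have := (hEprime p hp).one_lt
    exact div_nonneg (Real.log_nonneg (by exact_mod_cast this.le)) (Nat.cast_nonneg p)
  have h1 : ‖∑ d ∈ Finset.Icc 1 Y, T d‖ ≤ ∑ d ∈ Finset.Icc 1 Y, vonMangoldt d * ‖Sh a ν (y / d)‖ +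
      (2 * L * ((ν - 1) * y) + 2 * E.card * Real.log (ν * y)) := by
    refine (norm_sum_le _ _).trans ((Finset.sum_le_sum hTle).trans ?_)
    rw [Finset.sum_add_distrib, ← Finset.sum_filter]
    gcongr
    rw [Finset.sum_add_distrib, ← Finset.sum_mul, ← Finset.mul_sum]
    have hA := sum_vonMangoldt_div_le_of_primes hEprime Y
    have hB := sum_vonMangoldt_blocks_le_card_mul_log hEprime hY1
    have hlogY : Real.log Y ≤ Real.log (ν * y) :=
      Real.log_le_log (by exact_mod_cast hY1) (Nat.floor_le (by positivity))
    have hνy0 : 0 ≤ (ν - 1) * y := by nlinarith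
    have hcard0 : (0 : ℝ) ≤ E.card := Nat.cast_nonneg _
    calc (∑ d ∈ (Finset.Icc 1 Y).filter (fun d => ∃ p ∈ E, p ∣ d), (vonMangoldt d : ℝ) / d) * ((ν - 1) * y) +
          2 * ∑ d ∈ (Finset.Icc 1 Y).filter (fun d => ∃ p ∈ E, p ∣ d), (vonMangoldt d : ℝ)
        ≤ (2 * L) * ((ν - 1) * y) + 2 * (E.card * Real.log (ν * y)) := by
          refine add_le_add (mul_le_mul_of_nonneg_right (hA.trans (by linarith)) hνy0) ?_
          refine mul_le_mul_of_nonneg_left (hB.trans ?_) (by norm_num)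
          exact mul_le_mul_of_nonneg_left hlogY hcard0
      _ = 2 * L * ((ν - 1) * y) + 2 * E.card * Real.log (ν * y) := by ring
  have h2 : ((⌊ν * y⌋₊ : ℝ) - ⌊y⌋₊) * Real.log ν ≤ (ν - 1) * y + 1 := by
    have hfl := floor_sub_floor_le hν hy0.le
    have hlogν : Real.log ν ≤ 1 := by
      have h2' : Real.log ν ≤ Real.log 2 := Real.log_le_log hν0 hν2
      have := Real.log_two_lt_d9; linarith
    have hlogν0 : 0 ≤ Real.log ν := Real.log_nonneg hν
    have hfl0 : 0 ≤ (⌊ν * y⌋₊ : ℝ) - ⌊y⌋₊ := by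
      have : (⌊y⌋₊ : ℝ) ≤ ⌊ν * y⌋₊ := by exact_mod_cast Nat.floor_le_floor hyνy
      linarith
    calc ((⌊ν * y⌋₊ : ℝ) - ⌊y⌋₊) * Real.log ν ≤ ((ν - 1) * y + 1) * 1 :=
          mul_le_mul hfl hlogν hlogν0 (by linarith)
      _ = (ν - 1) * y + 1 := mul_one _
  linarith

/-! ### Lemma A2 for the restricted function over windows -/

/-- **Lemma A2 for windows of `a = g̃ 1_𝒮`**: if `C` is the constant of the tree's
`Halasz.exists_sum_abs_psi_sub_mul_kk_le`, then for `x ≥ 3`, `1 ≤ ν ≤ 2` and `∑_{p ∈ E} log p/p ≤ L`,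
`‖S_ν(x)‖ log x ≤ x ∫_{log 2}^{log x} ‖S_ν(e^u)‖ e^{-u} du + (3|C| + 10) x + 2L(ν-1)x + 2|E| log(νx)`.
[cite: GranvilleSoundararajan2003, Lemma 2.1, (2.1)] -/
theorem norm_Sh_restr_mul_log_le_integral {C : ℝ}
    (hC : ∀ z : ℝ, 3 ≤ z → ∑ d ∈ Finset.Icc 1 ⌊z⌋₊, |Chebyshev.psi d - d| * kk z d ≤ C * z)
    [DecidableEq ι] (h : IsBlockSystem 𝓙 blk N) (hg : ∀ m n, g (m * n) = g m * g n)
    (hgb : ∀ n, ‖g n‖ ≤ 1) {L : ℝ} (hL : ∑ p ∈ 𝓙.biUnion blk, Real.log p / p ≤ L)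
    {ν : ℝ} (hν : 1 ≤ ν) (hν2 : ν ≤ 2) {x : ℝ} (hx : 3 ≤ x) :
    ‖Sh (restr 𝓙 blk g N) ν x‖ * Real.log x ≤
      x * (∫ u in Real.log 2..Real.log x, normShExp (restr 𝓙 blk g N) ν u) +
        (3 * |C| + 10) * x + 2 * L * ((ν - 1) * x) + 2 * (𝓙.biUnion blk).card * Real.log (ν * x) := by
  have hab : ∀ n, ‖restr 𝓙 blk g N n‖ ≤ 1 := norm_restr_le_one hgb
  set a := restr 𝓙 blk g N with ha
  have hx1 : 1 ≤ x := by linarith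
  have hx0 : 0 < x := by linarith
  have h1 := norm_Sh_restr_mul_log_le h hg hgb hL hν hν2 hx1
  have h2 := sum_vonMangoldt_mul_Sh_le (g := a) hab hx0.le hν
  have h3 := sum_abs_psi_sub_mul_kk_window_le hC hx hν
  have hfl : ⌊x⌋₊ ≤ ⌊ν * x⌋₊ := Nat.floor_le_floor (by nlinarith)
  have hsplitd : ∑ d ∈ Finset.Icc 1 ⌊ν * x⌋₊, ‖Sh a ν (x / d)‖ =
      ∑ d ∈ Finset.Icc 1 ⌊x⌋₊, ‖Sh a ν (x / d)‖ + ∑ d ∈ Finset.Ioc ⌊x⌋₊ ⌊ν * x⌋₊, ‖Sh a ν (x / d)‖ := by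
    have e : ∀ n : ℕ, Finset.Icc 1 n = Finset.Ioc 0 n := fun n => by
      ext m; simp only [Finset.mem_Icc, Finset.mem_Ioc]; omega
    rw [e, e, ← Finset.sum_Ioc_consecutive _ (Nat.zero_le ⌊x⌋₊) hfl]
  have h4 := sum_norm_Sh_div_le (g := a) hab hx1 hν hν2
  have h5 := sum_norm_Sh_div_tail_le (g := a) hab hx1 hν hν2
  have hsplitI : ∫ u in (0:ℝ)..Real.log x, normShExp a ν u =
      (∫ u in (0:ℝ)..Real.log 2, normShExp a ν u) + ∫ u in Real.log 2..Real.log x, normShExp a ν u :=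
    (intervalIntegral.integral_add_adjacent_intervals (intervalIntegrable_normShExp hab hν _ _)
      (intervalIntegrable_normShExp hab hν _ _)).symm
  have hsmall := integral_normShExp_small_le (g := a) hab hν hν2
  rw [hsplitI] at h4
  have hYx : (⌊x⌋₊ : ℝ) ≤ x := Nat.floor_le hx0.le
  have hYνx : (⌊ν * x⌋₊ : ℝ) ≤ ν * x := Nat.floor_le (by nlinarith)
  have h6 : x * ∫ u in (0:ℝ)..Real.log 2, normShExp a ν u ≤ 2 * x := by nlinarith
  have hLnn : 0 ≤ L := le_trans (Finset.sum_nonneg fun p hp => by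
      have := (h.prime_of_mem_biUnion (t := 𝓙) le_rfl hp).one_lt
      exact div_nonneg (Real.log_nonneg (by exact_mod_cast this.le)) (Nat.cast_nonneg p)) hL
  have hC' : C * (x + ν * x) ≤ 3 * |C| * x := by
    have : C * (x + ν * x) ≤ |C| * (x + ν * x) := mul_le_mul_of_nonneg_right (le_abs_self C) (by nlinarith)
    have h' : |C| * (x + ν * x) ≤ |C| * (3 * x) := mul_le_mul_of_nonneg_left (by nlinarith) (abs_nonneg C)
    linarith
  rw [hsplitd] at h2
  nlinarith [mul_nonneg hLnn hx0.le]

end Restricted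

/-! ### GS03 (3.7) for windows: from `∫ ‖S_ν(e^u)‖ e^{-u}` to the `α`-integral of the kernel -/

/-- The window kernel `K_ν(α, u) = ‖A(νe^u) - A(e^u)‖ e^{-(1+2α)u}` is measurable on `ℝ × ℝ`. [folklore] -/
theorem measurable_kernelSh (b : ℕ → ℂ) (ν : ℝ) :
    Measurable fun p : ℝ × ℝ =>
      ‖psum b (ν * Real.exp p.2) - psum b (Real.exp p.2)‖ * Real.exp (-((1 + 2 * p.1) * p.2)) := by
  refine Measurable.mul ?_ ?_
  · exact (((MellinPlancherel.measurable_psum _).comp ((Real.measurable_exp.comp measurable_snd).const_mul ν)).sub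
      ((MellinPlancherel.measurable_psum _).comp (Real.measurable_exp.comp measurable_snd))).norm
  · exact (Real.measurable_exp.comp (by fun_prop))

/-- On the rectangle `α ∈ (α₀, 1]`, `u ∈ (log 2, log x]` (`α₀ ≥ 0`, `x ≥ 1`, `1 ≤ ν ≤ 2`), the window kernel of
`A = ∑_{n ≤ ·} g̃(n) log n` is bounded by `6 x log(2x)`. [folklore] -/
theorem kernelSh_le (hgb : ∀ n, ‖g n‖ ≤ 1) (N : ℕ) {x α₀ ν : ℝ} (hx : 1 ≤ x) (hα₀ : 0 ≤ α₀)
    (hν : 1 ≤ ν) (hν2 : ν ≤ 2)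
    {p : ℝ × ℝ} (hp : p ∈ Set.Ioc α₀ 1 ×ˢ Set.Ioc (Real.log 2) (Real.log x)) :
    ‖‖psum (mulLog g N) (ν * Real.exp p.2) - psum (mulLog g N) (Real.exp p.2)‖ *
        Real.exp (-((1 + 2 * p.1) * p.2))‖ ≤ 6 * x * Real.log (2 * x) := by
  obtain ⟨⟨hα1, -⟩, ⟨hu1, hu2⟩⟩ := hp
  have hlog2 : 0 < Real.log 2 := Real.log_pos (by norm_num)
  have hu0 : 0 < p.2 := hlog2.trans hu1
  have hx0 : 0 < x := by linarith
  have hexu : Real.exp p.2 ≤ x := by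
    calc Real.exp p.2 ≤ Real.exp (Real.log x) := Real.exp_le_exp.2 hu2
      _ = x := Real.exp_log hx0
  have he1 : 1 ≤ Real.exp p.2 := by simpa using Real.one_le_exp hu0.le
  have hνe1 : 1 ≤ ν * Real.exp p.2 := by nlinarith
  have hνe : ν * Real.exp p.2 ≤ 2 * x := by nlinarith
  have hlog2x : 0 ≤ Real.log (2 * x) := Real.log_nonneg (by linarith)
  rw [Real.norm_of_nonneg (by positivity)]
  have h1 : ‖psum (mulLog g N) (ν * Real.exp p.2)‖ ≤ 2 * x * Real.log (2 * x) := by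
    refine (norm_psum_mulLog_le_mul_log hgb N hνe1).trans ?_
    exact mul_le_mul hνe (Real.log_le_log (by positivity) hνe) (Real.log_nonneg hνe1) (by positivity)
  have h2 : ‖psum (mulLog g N) (Real.exp p.2)‖ ≤ 2 * x * Real.log (2 * x) := by
    refine (norm_psum_mulLog_le_mul_log hgb N he1).trans ?_
    exact mul_le_mul (by linarith) (Real.log_le_log (by positivity) (by linarith)) (Real.log_nonneg he1)
      (by positivity)
  have h3 : ‖psum (mulLog g N) (ν * Real.exp p.2) - psum (mulLog g N) (Real.exp p.2)‖ ≤ 4 * x * Real.log (2 * x) := by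
    refine (norm_sub_le _ _).trans ?_; linarith
  have h4 : Real.exp (-((1 + 2 * p.1) * p.2)) ≤ 1 := by
    rw [Real.exp_le_one_iff]
    have : 0 ≤ (1 + 2 * p.1) * p.2 := by
      have : 0 ≤ p.1 := hα₀.trans hα1.le
      positivity
    linarith
  have hxl : 0 ≤ x * Real.log (2 * x) := by positivity
  calc ‖psum (mulLog g N) (ν * Real.exp p.2) - psum (mulLog g N) (Real.exp p.2)‖ * Real.exp (-((1 + 2 * p.1) * p.2))
      ≤ 4 * x * Real.log (2 * x) * 1 := by gcongr
    _ ≤ 6 * x * Real.log (2 * x) := by linarith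

/-- The window kernel is integrable on the rectangle `(α₀, 1] × (log 2, log x]`. [folklore] -/
theorem integrable_kernelSh (hgb : ∀ n, ‖g n‖ ≤ 1) (N : ℕ) {x α₀ ν : ℝ} (hx : 1 ≤ x) (hα₀ : 0 ≤ α₀)
    (hν : 1 ≤ ν) (hν2 : ν ≤ 2) :
    Integrable (fun p : ℝ × ℝ =>
        ‖psum (mulLog g N) (ν * Real.exp p.2) - psum (mulLog g N) (Real.exp p.2)‖ *
          Real.exp (-((1 + 2 * p.1) * p.2)))
      ((volume.restrict (Set.Ioc α₀ 1)).prod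
        (volume.restrict (Set.Ioc (Real.log 2) (Real.log x)))) := by
  rw [Measure.prod_restrict, ← Measure.volume_eq_prod]
  refine Measure.integrableOn_of_bounded (M := 6 * x * Real.log (2 * x)) ?_
    (measurable_kernelSh (mulLog g N) ν).aestronglyMeasurable ?_
  · rw [Measure.volume_eq_prod, Measure.prod_prod]
    exact ENNReal.mul_ne_top measure_Ioc_lt_top.ne measure_Ioc_lt_top.ne
  · exact ae_restrict_of_forall_mem (measurableSet_Ioc.prod measurableSet_Ioc)
      fun p hp => kernelSh_le hgb N hx hα₀ hν hν2 hp

/-- **(A1) for windows in logarithmic coordinates**: if `(g̃ log)(n) = a(n) log n` for all `n` (e.g.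
`a = g̃ 1_𝒮`), then for `u > 0` and `ν ≥ 1`,
`‖S_ν(e^u)‖ e^{-u} ≤ ‖A(νe^u) - A(e^u)‖ e^{-u}/u + ((ν - 1) + e^{-u})(ν - 1)/u`, `A = psum (g̃ log)`.
[cite: GranvilleSoundararajan2003, §2 (proof of Lemma 2.1)] -/
theorem normShExp_le_kernel {a : ℕ → ℂ} (hab : ∀ n, ‖a n‖ ≤ 1) {N : ℕ}
    (hA : ∀ n : ℕ, mulLog a N n = a n * (Real.log n : ℂ)) {ν : ℝ} (hν : 1 ≤ ν)
    {u : ℝ} (hu : 0 < u) :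
    normShExp a ν u ≤ ‖psum (mulLog a N) (ν * Real.exp u) - psum (mulLog a N) (Real.exp u)‖ * Real.exp (-u) / u +
      ((ν - 1) + Real.exp (-u)) * (ν - 1) / u := by
  unfold normShExp
  have hy1 : (1 : ℝ) ≤ Real.exp u := by simpa using Real.one_le_exp hu.le
  have hy0 : 0 < Real.exp u := Real.exp_pos u
  have h := norm_Sh_mul_log_le_norm_sum hab hν hy1
  rw [Real.log_exp] at h
  have hwin : ∑ n ∈ Finset.Ioc ⌊Real.exp u⌋₊ ⌊ν * Real.exp u⌋₊, a n * (Real.log n : ℂ) =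
      psum (mulLog a N) (ν * Real.exp u) - psum (mulLog a N) (Real.exp u) := by
    have hyz : Real.exp u ≤ ν * Real.exp u := by nlinarith
    have e : ∀ n : ℕ, Finset.Icc 1 n = Finset.Ioc 0 n := fun n => by
      ext m; simp only [Finset.mem_Icc, Finset.mem_Ioc]; omega
    unfold psum
    simp_rw [hA]
    rw [e, e, ← Finset.sum_Ioc_consecutive _ (Nat.zero_le ⌊Real.exp u⌋₊) (Nat.floor_le_floor hyz)]
    ring
  rw [hwin] at h
  have hfl := floor_sub_floor_le hν hy0.le
  have hlogν : Real.log ν ≤ ν - 1 := by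
    have := Real.log_le_sub_one_of_pos (by linarith : 0 < ν); linarith
  have hlogν0 : 0 ≤ Real.log ν := Real.log_nonneg hν
  have hfl0 : 0 ≤ (⌊ν * Real.exp u⌋₊ : ℝ) - ⌊Real.exp u⌋₊ := by
    have : (⌊Real.exp u⌋₊ : ℝ) ≤ ⌊ν * Real.exp u⌋₊ := by exact_mod_cast Nat.floor_le_floor (by nlinarith)
    linarith
  have h2 : ((⌊ν * Real.exp u⌋₊ : ℝ) - ⌊Real.exp u⌋₊) * Real.log ν * Real.exp (-u) ≤ ((ν - 1) + Real.exp (-u)) * (ν - 1) := by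
    have e1 : ((ν - 1) * Real.exp u + 1) * Real.exp (-u) = (ν - 1) + Real.exp (-u) := by
      rw [add_mul, mul_assoc, ← Real.exp_add, add_neg_cancel, Real.exp_zero, mul_one, one_mul]
    calc ((⌊ν * Real.exp u⌋₊ : ℝ) - ⌊Real.exp u⌋₊) * Real.log ν * Real.exp (-u)
        = (((⌊ν * Real.exp u⌋₊ : ℝ) - ⌊Real.exp u⌋₊) * Real.exp (-u)) * Real.log ν := by ring
      _ ≤ (((ν - 1) * Real.exp u + 1) * Real.exp (-u)) * (ν - 1) := by
          refine mul_le_mul (mul_le_mul_of_nonneg_right hfl (Real.exp_pos _).le) hlogν hlogν0 ?_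
          positivity
      _ = ((ν - 1) + Real.exp (-u)) * (ν - 1) := by rw [e1]
  rw [← add_div, le_div_iff₀ hu]
  calc ‖Sh a ν (Real.exp u)‖ * Real.exp (-u) * u = ‖Sh a ν (Real.exp u)‖ * u * Real.exp (-u) := by ring
    _ ≤ (‖psum (mulLog a N) (ν * Real.exp u) - psum (mulLog a N) (Real.exp u)‖ +
          ((⌊ν * Real.exp u⌋₊ : ℝ) - ⌊Real.exp u⌋₊) * Real.log ν) * Real.exp (-u) :=
        mul_le_mul_of_nonneg_right h (Real.exp_pos _).le
    _ = ‖psum (mulLog a N) (ν * Real.exp u) - psum (mulLog a N) (Real.exp u)‖ * Real.exp (-u) +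
          ((⌊ν * Real.exp u⌋₊ : ℝ) - ⌊Real.exp u⌋₊) * Real.log ν * Real.exp (-u) := by ring
    _ ≤ _ := add_le_add le_rfl h2

/-- **GS03 (3.7) for windows, one-sided**: for `x ≥ 3`, `1 ≤ ν ≤ 2`, `(g̃ log)(n) = a(n) log n`, with
`α₀ = 1/(2 log x)`,
`∫_{log 2}^{log x} ‖S_ν(e^u)‖ e^{-u} du ≤ 17 ∫_{α₀}^{1} (∫_{log 2}^{log x} ‖A(νe^u) - A(e^u)‖ e^{-(1+2α)u} du) dα
  + (ν - 1)(log log x + 2)`. [cite: GranvilleSoundararajan2003, (3.7)] -/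
theorem integral_normShExp_le {a : ℕ → ℂ} (hab : ∀ n, ‖a n‖ ≤ 1) {N : ℕ}
    (hA : ∀ n : ℕ, mulLog a N n = a n * (Real.log n : ℂ)) {ν : ℝ} (hν : 1 ≤ ν) (hν2 : ν ≤ 2)
    {x : ℝ} (hx : 3 ≤ x) :
    ∫ u in Real.log 2..Real.log x, normShExp a ν u ≤
      17 * (∫ α in Set.Ioc (1 / (2 * Real.log x)) 1,
              ∫ u in Set.Ioc (Real.log 2) (Real.log x),
                ‖psum (mulLog a N) (ν * Real.exp u) - psum (mulLog a N) (Real.exp u)‖ *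
                  Real.exp (-((1 + 2 * α) * u))) +
        (ν - 1) * (Real.log (Real.log x) + 2) := by
  set α₀ : ℝ := 1 / (2 * Real.log x) with hα₀
  set S : Set ℝ := Set.Ioc α₀ 1 with hS
  set T : Set ℝ := Set.Ioc (Real.log 2) (Real.log x) with hT
  set K : ℝ → ℝ → ℝ := fun α u =>
    ‖psum (mulLog a N) (ν * Real.exp u) - psum (mulLog a N) (Real.exp u)‖ * Real.exp (-((1 + 2 * α) * u)) with hK
  set Gf : ℝ → ℝ := fun u => ((ν - 1) + Real.exp (-u)) * (ν - 1) / u with hGf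
  have hlog2 : (0.6931471803 : ℝ) < Real.log 2 := Real.log_two_gt_d9
  have hx1 : (1 : ℝ) ≤ x := by linarith
  have hlx : Real.log 2 ≤ Real.log x := Real.log_le_log (by norm_num) (by linarith)
  have hlx3 : 1 < Real.log x := by
    rw [← Real.log_exp 1]
    refine Real.log_lt_log (Real.exp_pos 1) ?_
    have := Real.exp_one_lt_d9
    linarith
  have hα₀0 : 0 ≤ α₀ := by rw [hα₀]; positivity
  have hν1 : 0 ≤ ν - 1 := by linarith
  -- integrability of the kernel in both orders
  have hKint := integrable_kernelSh hab N hx1 hα₀0 hν hν2 (x := x) (ν := ν)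
  have hKint' : Integrable (Function.uncurry fun u α => K α u)
      ((volume.restrict T).prod (volume.restrict S)) := hKint.swap
  have hIu : Integrable (fun u => ∫ α in S, K α u) (volume.restrict T) := by
    have := hKint'.integral_prod_left
    simpa [Function.uncurry] using this
  -- pointwise bound on `T`
  have hpt : ∀ u ∈ Set.Icc (Real.log 2) (Real.log x),
      normShExp a ν u ≤ 17 * (∫ α in S, K α u) + Gf u := by
    intro u hu
    have hu0 : 0 < u := by linarith [hu.1]
    refine (normShExp_le_kernel hab hA hν hu0).trans ?_
    gcongr ?_ + _
    have hrep := inv_le_integral_exp (x := x) hu.1 hu.2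
    have hA0 : 0 ≤ ‖psum (mulLog a N) (ν * Real.exp u) - psum (mulLog a N) (Real.exp u)‖ * Real.exp (-u) := by
      positivity
    calc ‖psum (mulLog a N) (ν * Real.exp u) - psum (mulLog a N) (Real.exp u)‖ * Real.exp (-u) / u
        = ‖psum (mulLog a N) (ν * Real.exp u) - psum (mulLog a N) (Real.exp u)‖ * Real.exp (-u) * (1 / u) := by ring
      _ ≤ ‖psum (mulLog a N) (ν * Real.exp u) - psum (mulLog a N) (Real.exp u)‖ * Real.exp (-u) *
            (17 * ∫ α in (1 / (2 * Real.log x))..1, Real.exp (-(2 * α * u))) := by gcongr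
      _ = 17 * ∫ α in α₀..1, ‖psum (mulLog a N) (ν * Real.exp u) - psum (mulLog a N) (Real.exp u)‖ *
            Real.exp (-u) * Real.exp (-(2 * α * u)) := by
          rw [intervalIntegral.integral_const_mul]; ring
      _ = 17 * ∫ α in S, K α u := by
          rw [intervalIntegral.integral_of_le (by
            rw [hα₀]; rw [div_le_one (by positivity)]; linarith)]
          congr 1
          refine setIntegral_congr_fun measurableSet_Ioc fun α _ => ?_
          simp only [hK]
          rw [mul_assoc, ← Real.exp_add]
          congr 2
          ring
  -- the garbage function and its integral
  have hGpt : ∀ u ∈ Set.Icc (Real.log 2) (Real.log x), Gf u ≤ (ν - 1) ^ 2 * (1 / u) + 2 * (ν - 1) * Real.exp (-u) := by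
    intro u hu
    have hu0 : 0 < u := by linarith [hu.1]
    have hinvu : 1 / u ≤ 2 := by rw [div_le_iff₀ hu0]; linarith [hu.1]
    simp only [hGf]
    rw [div_eq_mul_one_div]
    have h1 : Real.exp (-u) * (ν - 1) * (1 / u) ≤ Real.exp (-u) * (ν - 1) * 2 :=
      mul_le_mul_of_nonneg_left hinvu (by positivity)
    nlinarith [h1, Real.exp_pos (-u), sq_nonneg (ν - 1)]
  have hGint_inv : IntervalIntegrable (fun u : ℝ => 1 / u) volume (Real.log 2) (Real.log x) := by
    refine (continuousOn_const.div continuousOn_id fun u hu => ?_).intervalIntegrable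
    rw [Set.uIcc_of_le hlx] at hu
    exact (ne_of_gt (by linarith [hu.1] : (0:ℝ) < u))
  have hGint_exp : IntervalIntegrable (fun u : ℝ => Real.exp (-u)) volume (Real.log 2) (Real.log x) :=
    (by fun_prop : Continuous fun u : ℝ => Real.exp (-u)).intervalIntegrable _ _
  have hGcont : ContinuousOn Gf (Set.uIcc (Real.log 2) (Real.log x)) := by
    simp only [hGf]
    refine ContinuousOn.div (by fun_prop) continuousOn_id fun u hu => ?_
    rw [Set.uIcc_of_le hlx] at hu
    exact (ne_of_gt (by linarith [hu.1] : (0:ℝ) < u))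
  have hGint : IntervalIntegrable Gf volume (Real.log 2) (Real.log x) := hGcont.intervalIntegrable
  have hGval : ∫ u in Real.log 2..Real.log x, Gf u ≤ (ν - 1) * (Real.log (Real.log x) + 2) := by
    have hmono : ∫ u in Real.log 2..Real.log x, Gf u ≤
        ∫ u in Real.log 2..Real.log x, ((ν - 1) ^ 2 * (1 / u) + 2 * (ν - 1) * Real.exp (-u)) :=
      intervalIntegral.integral_mono_on hlx hGint ((hGint_inv.const_mul _).add (hGint_exp.const_mul _)) hGpt
    refine hmono.trans ?_
    rw [intervalIntegral.integral_add (hGint_inv.const_mul _) (hGint_exp.const_mul _),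
      intervalIntegral.integral_const_mul, intervalIntegral.integral_const_mul,
      integral_one_div_of_pos (by linarith) (by linarith),
      intervalIntegral.integral_comp_neg (fun u => Real.exp u), integral_exp]
    -- `log(log x/log 2) ≤ log log x + 1` and `e^{-log 2} - e^{-log x} ≤ 1/2`
    have h1 : Real.log (Real.log x / Real.log 2) ≤ Real.log (Real.log x) + 1 := by
      rw [Real.log_div (by linarith) (by linarith)]
      have : -1 ≤ Real.log (Real.log 2) := by
        rw [← Real.log_exp (-1)]
        refine Real.log_le_log (Real.exp_pos _) ?_
        rw [Real.exp_neg]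
        have := Real.exp_one_gt_d9
        rw [inv_le_comm₀ (Real.exp_pos 1) (by linarith)]
        have h2 : (Real.log 2)⁻¹ ≤ 2 := by
          rw [inv_le_comm₀ (by linarith) (by norm_num)]; linarith
        linarith
      linarith
    have h2 : Real.exp (-Real.log 2) - Real.exp (-Real.log x) ≤ 1 / 2 := by
      rw [Real.exp_neg, Real.exp_log (by norm_num)]
      have := Real.exp_pos (-Real.log x)
      linarith
    have hll0 : 0 ≤ Real.log (Real.log x) + 1 := by
      have : 0 ≤ Real.log (Real.log x) := Real.log_nonneg hlx3.le
      linarith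
    calc (ν - 1) ^ 2 * Real.log (Real.log x / Real.log 2) + 2 * (ν - 1) * (Real.exp (-Real.log 2) - Real.exp (-Real.log x))
        ≤ (ν - 1) ^ 2 * (Real.log (Real.log x) + 1) + 2 * (ν - 1) * (1 / 2) := by
          gcongr
      _ ≤ (ν - 1) * (Real.log (Real.log x) + 1) + (ν - 1) := by
          have : (ν - 1) ^ 2 ≤ (ν - 1) * 1 := by nlinarith
          nlinarith
      _ = (ν - 1) * (Real.log (Real.log x) + 2) := by ring
  -- integrate the pointwise bound
  have hnormInt := intervalIntegrable_normShExp hab hν (Real.log 2) (Real.log x)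
  have hRint : IntervalIntegrable (fun u => 17 * (∫ α in S, K α u) + Gf u) volume (Real.log 2) (Real.log x) := by
    refine IntervalIntegrable.add ?_ hGint
    rw [intervalIntegrable_iff_integrableOn_Ioc_of_le hlx]
    exact hIu.const_mul 17
  calc ∫ u in Real.log 2..Real.log x, normShExp a ν u
      ≤ ∫ u in Real.log 2..Real.log x, (17 * (∫ α in S, K α u) + Gf u) :=
        intervalIntegral.integral_mono_on hlx hnormInt hRint hpt
    _ = 17 * (∫ u in Real.log 2..Real.log x, ∫ α in S, K α u) + ∫ u in Real.log 2..Real.log x, Gf u := by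
        rw [intervalIntegral.integral_add ?_ hGint, intervalIntegral.integral_const_mul]
        rw [intervalIntegrable_iff_integrableOn_Ioc_of_le hlx]
        exact hIu.const_mul 17
    _ ≤ 17 * (∫ α in S, ∫ u in T, K α u) + (ν - 1) * (Real.log (Real.log x) + 2) := by
        refine add_le_add (le_of_eq ?_) hGval
        congr 1
        rw [intervalIntegral.integral_of_le hlx]
        exact integral_integral_swap hKint'

/-! ### Cauchy–Schwarz in `u` for windows: the bound for `I_ν(α)` -/

namespace Restricted

variable {ι : Type*} {𝓙 : Finset ι} {blk : ι → Finset ℕ} {N : ℕ}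

set_option maxHeartbeats 800000 in
/-- The square-root bookkeeping for windows: if
`J ≤ 2B²(4η²/α + G) + 2(e^{12}/α)² m² (8η² log Q + G) + (25/π) Tl`, `Tl = 240/T₀ + (1920 + 520e^{10}/α³)/T₀²`,
with `0 ≤ B ≤ e^{12}/α`, `0 < α ≤ 1`, `T₀ ≥ 1`, `G, log Q, m, η ≥ 0`, then
`√(J/(2α)) ≤ 2ηB/α + e^{12}(√G + m √(8η² log Q + G))/(α√α) + (32/√T₀ + 90/T₀)/√α + 47e⁵/(α²T₀)`. [folklore] -/
theorem sqrt_meanSquare_interval_bound_le {J B m Lq G η α T₀ : ℝ} (hα : 0 < α) (hα1 : α ≤ 1) (hT₀ : 1 ≤ T₀)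
    (hB : 0 ≤ B) (hBle : B ≤ Real.exp 12 / α) (hm : 0 ≤ m) (hLq : 0 ≤ Lq) (hG : 0 ≤ G) (hη : 0 ≤ η)
    (hJ : J ≤ 2 * B ^ 2 * (4 * η ^ 2 / α + G) + 2 * (Real.exp 12 / α) ^ 2 * m ^ 2 * (8 * η ^ 2 * Lq + G) +
      25 / π * (240 / T₀ + (1920 + 520 * Real.exp 10 / α ^ 3) / T₀ ^ 2)) :
    Real.sqrt (J * (1 / (2 * α))) ≤
      2 * η * B / α + Real.exp 12 * (Real.sqrt G + m * Real.sqrt (8 * η ^ 2 * Lq + G)) / (α * Real.sqrt α) +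
        (32 / Real.sqrt T₀ + 90 / T₀) / Real.sqrt α + 47 * Real.exp 5 / (α ^ 2 * T₀) := by
  have hT0 : 0 < T₀ := by linarith
  have hsα0 : 0 < Real.sqrt α := Real.sqrt_pos.mpr hα
  have hsα : Real.sqrt α ^ 2 = α := Real.sq_sqrt hα.le
  have hsT0 : 0 < Real.sqrt T₀ := Real.sqrt_pos.mpr hT0
  have hsT : Real.sqrt T₀ ^ 2 = T₀ := Real.sq_sqrt hT0.le
  have hsG : Real.sqrt G ^ 2 = G := Real.sq_sqrt hG
  have hW0 : 0 ≤ 8 * η ^ 2 * Lq + G := by positivity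
  have hsW : Real.sqrt (8 * η ^ 2 * Lq + G) ^ 2 = 8 * η ^ 2 * Lq + G := Real.sq_sqrt hW0
  have hπ3 : 25 / π ≤ 25 / 3 := div_le_div_of_nonneg_left (by norm_num) (by norm_num) Real.pi_gt_three.le
  have he10 : Real.exp 10 = Real.exp 5 ^ 2 := by rw [← Real.exp_nat_mul]; norm_num
  have he24 : Real.exp 12 ^ 2 = Real.exp 24 := by rw [← Real.exp_nat_mul]; norm_num
  set t₁ : ℝ := 2 * η * B / α with ht₁
  set t₂ : ℝ := Real.exp 12 * (Real.sqrt G + m * Real.sqrt (8 * η ^ 2 * Lq + G)) / (α * Real.sqrt α) with ht₂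
  set t₃ : ℝ := (32 / Real.sqrt T₀ + 90 / T₀) / Real.sqrt α with ht₃
  set t₄ : ℝ := 47 * Real.exp 5 / (α ^ 2 * T₀) with ht₄
  have ht₁0 : 0 ≤ t₁ := by positivity
  have ht₂0 : 0 ≤ t₂ := by positivity
  have ht₃0 : 0 ≤ t₃ := by positivity
  have ht₄0 : 0 ≤ t₄ := by positivity
  -- term 1
  have hA : 2 * B ^ 2 * (4 * η ^ 2 / α) * (1 / (2 * α)) = t₁ ^ 2 := by
    rw [ht₁]; field_simp; ring
  -- terms 2 and 3
  have hα3 : α ^ 3 ≤ α := by nlinarith [mul_le_one₀ hα1 hα.le hα1]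
  have hB2 : B ^ 2 ≤ Real.exp 24 / α ^ 2 := by
    have := pow_le_pow_left₀ hB hBle 2
    rwa [div_pow, he24] at this
  have hBC : (2 * B ^ 2 * G + 2 * (Real.exp 12 / α) ^ 2 * m ^ 2 * (8 * η ^ 2 * Lq + G)) * (1 / (2 * α)) ≤ t₂ ^ 2 := by
    have e2 : t₂ ^ 2 = Real.exp 24 * (Real.sqrt G + m * Real.sqrt (8 * η ^ 2 * Lq + G)) ^ 2 / α ^ 3 := by
      rw [ht₂, div_pow, mul_pow, mul_pow, hsα, he24]; ring
    have hsq : G + m ^ 2 * (8 * η ^ 2 * Lq + G) ≤ (Real.sqrt G + m * Real.sqrt (8 * η ^ 2 * Lq + G)) ^ 2 := by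
      have hcross : 0 ≤ 2 * Real.sqrt G * (m * Real.sqrt (8 * η ^ 2 * Lq + G)) := by positivity
      nlinarith [hsG, hsW]
    have h1 : 2 * B ^ 2 * G * (1 / (2 * α)) ≤ Real.exp 24 * G / α ^ 3 := by
      have : 2 * B ^ 2 * G * (1 / (2 * α)) = B ^ 2 * G / α := by field_simp
      rw [this]
      calc B ^ 2 * G / α ≤ (Real.exp 24 / α ^ 2) * G / α := by gcongr
        _ = Real.exp 24 * G / α ^ 3 := by field_simp
    have h2 : 2 * (Real.exp 12 / α) ^ 2 * m ^ 2 * (8 * η ^ 2 * Lq + G) * (1 / (2 * α)) =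
        Real.exp 24 * (m ^ 2 * (8 * η ^ 2 * Lq + G)) / α ^ 3 := by
      rw [div_pow, he24]; field_simp
    have h3 : Real.exp 24 * G / α ^ 3 + Real.exp 24 * (m ^ 2 * (8 * η ^ 2 * Lq + G)) / α ^ 3 ≤ t₂ ^ 2 := by
      rw [e2]
      calc Real.exp 24 * G / α ^ 3 + Real.exp 24 * (m ^ 2 * (8 * η ^ 2 * Lq + G)) / α ^ 3
          = Real.exp 24 * (G + m ^ 2 * (8 * η ^ 2 * Lq + G)) / α ^ 3 := by ring
        _ ≤ Real.exp 24 * (Real.sqrt G + m * Real.sqrt (8 * η ^ 2 * Lq + G)) ^ 2 / α ^ 3 := by gcongr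
    rw [add_mul, h2]
    linarith [h1, h3]
  -- term 4
  have hD : 25 / π * (240 / T₀ + (1920 + 520 * Real.exp 10 / α ^ 3) / T₀ ^ 2) * (1 / (2 * α)) ≤ t₃ ^ 2 + t₄ ^ 2 := by
    have e3 : t₃ ^ 2 = (32 / Real.sqrt T₀ + 90 / T₀) ^ 2 / α := by rw [ht₃, div_pow, hsα]
    have e4 : t₄ ^ 2 = 2209 * Real.exp 10 / (α ^ 4 * T₀ ^ 2) := by
      rw [ht₄, he10, div_pow, mul_pow, mul_pow]; ring
    have hsq3 : 1024 / T₀ + 8100 / T₀ ^ 2 ≤ (32 / Real.sqrt T₀ + 90 / T₀) ^ 2 := by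
      have h49 : (32 / Real.sqrt T₀) ^ 2 = 1024 / T₀ := by rw [div_pow, hsT]; norm_num
      have h324 : (90 / T₀) ^ 2 = 8100 / T₀ ^ 2 := by rw [div_pow]; norm_num
      have hcross : 0 ≤ 2 * (32 / Real.sqrt T₀) * (90 / T₀) := by positivity
      nlinarith
    have hpos : 0 ≤ (240 / T₀ + (1920 + 520 * Real.exp 10 / α ^ 3) / T₀ ^ 2) * (1 / (2 * α)) := by positivity
    calc 25 / π * (240 / T₀ + (1920 + 520 * Real.exp 10 / α ^ 3) / T₀ ^ 2) * (1 / (2 * α))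
        = 25 / π * ((240 / T₀ + (1920 + 520 * Real.exp 10 / α ^ 3) / T₀ ^ 2) * (1 / (2 * α))) := by ring
      _ ≤ 25 / 3 * ((240 / T₀ + (1920 + 520 * Real.exp 10 / α ^ 3) / T₀ ^ 2) * (1 / (2 * α))) :=
          mul_le_mul_of_nonneg_right hπ3 hpos
      _ = (1000 / T₀ + 8000 / T₀ ^ 2) / α + (6500 / 3) * Real.exp 10 / (α ^ 4 * T₀ ^ 2) := by
          field_simp; ring
      _ ≤ (1024 / T₀ + 8100 / T₀ ^ 2) / α + 2209 * Real.exp 10 / (α ^ 4 * T₀ ^ 2) := by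
          gcongr <;> norm_num
      _ ≤ t₃ ^ 2 + t₄ ^ 2 := by
          rw [e3, e4]
          exact add_le_add (div_le_div_of_nonneg_right hsq3 hα.le) le_rfl
  -- assemble
  have h0 : 0 < 1 / (2 * α) := by positivity
  have hJ' : J * (1 / (2 * α)) ≤ t₁ ^ 2 + t₂ ^ 2 + (t₃ ^ 2 + t₄ ^ 2) := by
    have := mul_le_mul_of_nonneg_right hJ h0.le
    refine this.trans ?_
    have e : (2 * B ^ 2 * (4 * η ^ 2 / α + G) + 2 * (Real.exp 12 / α) ^ 2 * m ^ 2 * (8 * η ^ 2 * Lq + G) +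
        25 / π * (240 / T₀ + (1920 + 520 * Real.exp 10 / α ^ 3) / T₀ ^ 2)) * (1 / (2 * α)) =
        2 * B ^ 2 * (4 * η ^ 2 / α) * (1 / (2 * α)) +
        (2 * B ^ 2 * G + 2 * (Real.exp 12 / α) ^ 2 * m ^ 2 * (8 * η ^ 2 * Lq + G)) * (1 / (2 * α)) +
        25 / π * (240 / T₀ + (1920 + 520 * Real.exp 10 / α ^ 3) / T₀ ^ 2) * (1 / (2 * α)) := by ring
    rw [e, hA]
    linarith
  have hsum : J * (1 / (2 * α)) ≤ (t₁ + t₂ + t₃ + t₄) ^ 2 :=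
    hJ'.trans (le_trans (by linarith) (sq_add_four_le ht₁0 ht₂0 ht₃0 ht₄0))
  calc Real.sqrt (J * (1 / (2 * α))) ≤ Real.sqrt ((t₁ + t₂ + t₃ + t₄) ^ 2) := Real.sqrt_le_sqrt hsum
    _ = t₁ + t₂ + t₃ + t₄ := Real.sqrt_sq (by positivity)

/-- The `J_ν`-integrand is integrable over `ℝ` (from `φ_ν ∈ L²`, `MellinPlancherel.memLp_two_phiI`). [folklore] -/
theorem integrable_meanSquare_interval_integrand {a : ℕ → ℂ} (hab : ∀ n, ‖a n‖ ≤ 1) (N : ℕ) {α : ℝ}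
    (hα : 0 < α) {ν : ℝ} (hν : 0 < ν) :
    Integrable fun u : ℝ =>
      ‖psum (mulLog a N) (ν * Real.exp u) - psum (mulLog a N) (Real.exp u)‖ ^ 2 * Real.exp (-(2 * (1 + α) * u)) := by
  have hmem := MellinPlancherel.memLp_two_phiI (a := mulLog a N) (σ := 1 + α)
    (fun y hy => norm_psum_mulLog_le hab hα y hy) (show 1 + α / 2 < 1 + α by linarith) hν
  have hint := (memLp_two_iff_integrable_sq_norm hmem.1).1 hmem
  refine hint.congr (Filter.Eventually.of_forall fun u => ?_)
  simp only [MellinPlancherel.norm_phiI]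
  rw [mul_pow, ← Real.exp_nat_mul]
  ring_nf

/-- **GS03 (3.8) for the restricted function over windows**: for a block system of primes `≤ Q` (`Q ≥ e²`)
at level `N = ⌊x_N⌋` (`x_N ≥ 3`), `1 ≤ x_u`, `0 < α ≤ 1`, `T₀ ≥ 1`, `1 < ν ≤ 2`, a PNT constant `C`, and
`‖𝒢_a(1+α+iy)‖ ≤ B ≤ e^{12}/α` for `|y| ≤ T₀`:
`∫_{log 2}^{log x_u} |A(νe^u) - A(e^u)| e^{-(1+2α)u} du ≤ 2ηB/α + F/(α√α) + (32/√T₀ + 90/T₀)/√α + 47e⁵/(α²T₀)`,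
`η = ν - 1`, `F = e^{12}(√G + |𝓙| √(8η² log Q + G))`, `G = 16 u₁ + 256`. [cite: GranvilleSoundararajan2003, (3.8)] -/
theorem inner_integral_restr_interval_le [DecidableEq ι] {xN : ℝ} (h : IsBlockSystem 𝓙 blk ⌊xN⌋₊)
    (hg : ∀ m n, g (m * n) = g m * g n) (hg1 : g 1 = 1) (hgb : ∀ n, ‖g n‖ ≤ 1) (hxN : 3 ≤ xN)
    {xu : ℝ} (hxu : 1 ≤ xu)
    {C : ℝ} (hC0 : 0 ≤ C) (hC : ∀ z : ℝ, 2 ≤ z → |θ z - z| ≤ C * z / Real.log z ^ (6 : ℝ))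
    {α : ℝ} (hα : 0 < α) (hα1 : α ≤ 1) {T₀ : ℝ} (hT₀ : 1 ≤ T₀) {Q : ℝ} (hQ : Real.exp 2 ≤ Q)
    (hblkQ : ∀ i ∈ 𝓙, ∀ p ∈ blk i, (p : ℝ) ≤ Q) {ν : ℝ} (hν : 1 < ν) (hν2 : ν ≤ 2) {B : ℝ} (hB0 : 0 ≤ B)
    (hBle : B ≤ Real.exp 12 / α)
    (hB : ∀ y : ℝ, |y| ≤ T₀ → ‖LSeries (restr 𝓙 blk g ⌊xN⌋₊) (1 + α + y * I)‖ ≤ B) :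
    ∫ u in Set.Ioc (Real.log 2) (Real.log xu),
        ‖psum (mulLog (restr 𝓙 blk g ⌊xN⌋₊) ⌊xN⌋₊) (ν * Real.exp u) -
            psum (mulLog (restr 𝓙 blk g ⌊xN⌋₊) ⌊xN⌋₊) (Real.exp u)‖ * Real.exp (-((1 + 2 * α) * u)) ≤
      2 * (ν - 1) * B / α +
        Real.exp 12 * (Real.sqrt (16 * uPNT C ν + 256) +
          𝓙.card * Real.sqrt (8 * (ν - 1) ^ 2 * Real.log Q + (16 * uPNT C ν + 256))) / (α * Real.sqrt α) +
        (32 / Real.sqrt T₀ + 90 / T₀) / Real.sqrt α + 47 * Real.exp 5 / (α ^ 2 * T₀) := by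
  set N : ℕ := ⌊xN⌋₊ with hN
  set a := restr 𝓙 blk g N with ha_def
  have hab : ∀ n, ‖a n‖ ≤ 1 := norm_restr_le_one hgb
  have hν0 : 0 < ν := by linarith
  set μ : Measure ℝ := volume.restrict (Set.Ioc (Real.log 2) (Real.log xu)) with hμ
  set f : ℝ → ℝ := fun u => ‖psum (mulLog a N) (ν * Real.exp u) - psum (mulLog a N) (Real.exp u)‖ *
    Real.exp (-((1 + α) * u)) with hf
  set hh : ℝ → ℝ := fun u => Real.exp (-(α * u)) with hhh
  -- the crude bound for the sub-systems and the mean square bound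
  set Bc : ℝ := Real.exp 12 / α with hBc
  have hBc' : ∀ i ∈ 𝓙, ∀ y : ℝ, ‖LSeries (restr (𝓙.erase i) blk g N) (1 + α + y * I)‖ ≤ Bc := by
    intro i _ y
    refine (norm_LSeries_restr_le_min (h.mono (Finset.erase_subset i 𝓙)) hg hg1 hgb hxN hα hα1 y).trans ?_
    rw [hBc]
    calc Real.exp 12 * min (Real.log xN) (1 / α) ≤ Real.exp 12 * (1 / α) := by gcongr; exact min_le_right _ _
      _ = Real.exp 12 / α := by ring
  set G : ℝ := 16 * uPNT C ν + 256 with hG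
  have hG0 : 0 ≤ G := by have := one_le_uPNT hC0 hν; rw [hG]; linarith
  have hQ0 : 0 < Q := lt_of_lt_of_le (Real.exp_pos 2) hQ
  have hlogQ : 0 ≤ Real.log Q := by
    rw [← Real.log_exp 0]; exact Real.log_le_log (Real.exp_pos 0) (le_trans (Real.exp_le_exp.mpr (by norm_num)) hQ)
  set Jb : ℝ := 2 * B ^ 2 * (4 * (ν - 1) ^ 2 / α + G) +
    2 * Bc ^ 2 * (𝓙.card : ℝ) ^ 2 * (8 * (ν - 1) ^ 2 * Real.log Q + G) +
    25 / π * (240 / T₀ + (1920 + 520 * Real.exp 10 / α ^ 3) / T₀ ^ 2) with hJb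
  have hJ := meanSquare_mulLog_restr_interval_le h hg hg1 hgb hC0 hC hα hα1 hT₀ hQ hblkQ hν hν2 hB hBc'
  have hT0 : 0 < T₀ := by linarith
  have hJb0 : 0 ≤ Jb := by
    have : 0 ≤ (ν - 1) := by linarith
    positivity
  -- the integrand is `f * h`
  have hfh : ∀ u, ‖psum (mulLog a N) (ν * Real.exp u) - psum (mulLog a N) (Real.exp u)‖ *
      Real.exp (-((1 + 2 * α) * u)) = f u * hh u := by
    intro u
    simp only [hf, hhh]
    rw [mul_assoc, ← Real.exp_add]
    congr 2
    ring
  simp_rw [hfh]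
  -- measurability and bounds for Hölder
  have hfmeas : AEStronglyMeasurable f μ := by
    refine (Measurable.aestronglyMeasurable ?_)
    refine Measurable.mul ?_ (Real.measurable_exp.comp (by fun_prop))
    exact (((MellinPlancherel.measurable_psum _).comp (Real.measurable_exp.const_mul ν)).sub
      ((MellinPlancherel.measurable_psum _).comp Real.measurable_exp)).norm
  have hhmeas : AEStronglyMeasurable hh μ := (by fun_prop : Continuous hh).aestronglyMeasurable
  have hlog2 : 0 < Real.log 2 := Real.log_pos (by norm_num)
  have hfbd : ∀ᵐ u ∂μ, ‖f u‖ ≤ 6 * xu * Real.log (2 * xu) := by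
    refine ae_restrict_of_forall_mem measurableSet_Ioc fun u hu => ?_
    have h1 := kernelSh_le hab N hxu (by positivity : (0:ℝ) ≤ α / 4) hν.le hν2 (p := (α / 2, u))
      ⟨⟨by simp only; linarith, by simp only; linarith⟩, hu⟩
    simp only at h1
    simp only [hf]
    convert h1 using 4
    ring
  have hhbd : ∀ᵐ u ∂μ, ‖hh u‖ ≤ 1 := by
    refine ae_restrict_of_forall_mem measurableSet_Ioc fun u hu => ?_
    simp only [hhh, Real.norm_eq_abs, abs_of_pos (Real.exp_pos _), Real.exp_le_one_iff]
    have : 0 < u := hlog2.trans hu.1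
    nlinarith
  have hfmem : MemLp f (ENNReal.ofReal 2) μ := by
    rw [ENNReal.ofReal_ofNat]; exact MemLp.of_bound hfmeas _ hfbd
  have hhmem : MemLp hh (ENNReal.ofReal 2) μ := by
    rw [ENNReal.ofReal_ofNat]; exact MemLp.of_bound hhmeas _ hhbd
  have hH := integral_mul_le_Lp_mul_Lq_of_nonneg Real.HolderConjugate.two_two
    (Filter.Eventually.of_forall fun u => by positivity)
    (Filter.Eventually.of_forall fun u => (Real.exp_pos _).le) hfmem hhmem
  -- bound the two factors
  have hf2 : ∫ u, f u ^ (2:ℝ) ∂μ ≤ Jb := by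
    simp_rw [Real.rpow_two]
    have hint := integrable_meanSquare_interval_integrand hab N hα hν0
    have heq : ∀ u, f u ^ 2 = ‖psum (mulLog a N) (ν * Real.exp u) - psum (mulLog a N) (Real.exp u)‖ ^ 2 *
        Real.exp (-(2 * (1 + α) * u)) := by
      intro u
      simp only [hf]
      rw [mul_pow, ← Real.exp_nat_mul]
      congr 2
      push_cast
      ring
    simp_rw [heq]
    exact (setIntegral_le_integral hint (Filter.Eventually.of_forall fun u => by positivity)).trans hJ
  have hh2 : ∫ u, hh u ^ (2:ℝ) ∂μ ≤ 1 / (2 * α) := by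
    simp_rw [Real.rpow_two]
    have heq : ∀ u, hh u ^ 2 = Real.exp (-(2 * α) * u) := by
      intro u
      simp only [hhh]
      rw [← Real.exp_nat_mul]
      congr 1
      push_cast
      ring
    simp_rw [heq]
    exact setIntegral_exp_neg_le hα
  have hf2_0 : 0 ≤ ∫ u, f u ^ (2:ℝ) ∂μ := integral_nonneg fun u => by positivity
  have hh2_0 : 0 ≤ ∫ u, hh u ^ (2:ℝ) ∂μ := integral_nonneg fun u => by positivity
  calc ∫ u, f u * hh u ∂μ
      ≤ (∫ u, f u ^ (2:ℝ) ∂μ) ^ (1 / (2:ℝ)) * (∫ u, hh u ^ (2:ℝ) ∂μ) ^ (1 / (2:ℝ)) := hH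
    _ ≤ Jb ^ (1 / (2:ℝ)) * (1 / (2 * α)) ^ (1 / (2:ℝ)) := by gcongr
    _ = Real.sqrt (Jb * (1 / (2 * α))) := by
        rw [Real.sqrt_eq_rpow, Real.mul_rpow hJb0 (by positivity)]
    _ ≤ _ := sqrt_meanSquare_interval_bound_le hα hα1 hT₀ hB0 hBle (Nat.cast_nonneg _) hlogQ hG0
        (by linarith : 0 ≤ ν - 1) (le_of_eq (by simp only [hJb, hBc]))

end Restricted

/-! ### Halász's theorem for the restricted sum over multiplicative windows -/

namespace Restricted

/-- `√(a + b) ≤ √a + √b` for `a, b ≥ 0`. [folklore] -/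
theorem sqrt_add_le' {a b : ℝ} (ha : 0 ≤ a) (hb : 0 ≤ b) : Real.sqrt (a + b) ≤ Real.sqrt a + Real.sqrt b := by
  rw [Real.sqrt_le_left (by positivity)]
  have h1 := Real.sq_sqrt ha
  have h2 := Real.sq_sqrt hb
  nlinarith [Real.sqrt_nonneg a, Real.sqrt_nonneg b]

set_option maxHeartbeats 3200000 in
-- one long bookkeeping proof (eleven term estimates); the default budget is too small
/-- **Halász's theorem for block-restricted sums over multiplicative windows.**  There is an absolute `K > 0`
such that for every completely multiplicative `g : ℕ → ℂ` with `|g| ≤ 1`, all `x ≥ 3`, `T ≥ 4`, `Q ≥ e²`,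
`1 < ν ≤ 2`, every block system `blk i` (`i ∈ 𝓙 ⊆ ℕ`) of pairwise disjoint sets of primes `≤ min(νx, Q)`
(at level `N = ⌊νx⌋`), with `𝒮 = {n : n has a prime factor in every block}`, `E = ⋃ blk i` and
`M_½ = min_{|t| ≤ T} 𝔻_½(g, n^{it}; νx)²` (`minHalfDistSq`):

`|∑_{x < n ≤ νx, n ∈ 𝒮} g(n)| ≤ K ( (ν-1) x ((1 + M_½) e^{-M_½} + 1/T + (|𝓙| + 1) √((log Q + 2)/log x))`
`  + (|𝓙| + 1) x (ν-1)^{-1/12}/√(log x) + x/log x + x/T + |E| )`.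

The first line is `(ν - 1)` times the bound of the tree's `norm_restr_sum_le` for the initial sum `∑_{n ≤ x}` —
the point of the theorem: differencing two initial sums would lose the factor `ν - 1`; the second line is
garbage, small as soon as `ν - 1` is not astronomically small, `log Q = o(log x)` and `|E| = o(x)`.  Proof:
Granville–Soundararajan's method (Canad. J. Math. 2003) for the window sums `S_a(νy) - S_a(y)` of
`a = g̃ 1_𝒮`: Lemma 2.1 over windows (`norm_Sh_restr_mul_log_le_integral`), the `α`-representation
(`integral_normShExp_le`), Cauchy–Schwarz with the interval mean square of
`HalaszRestrictedShortMeanSquare.lean` (`inner_integral_restr_interval_le`: Mellin–Plancherel with the window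
multiplier and the prime number theorem for the `Λ`-polynomials), and the two-regime `α`-integration of the tree.
[folklore] -/
theorem norm_restr_interval_sum_le :
    ∃ K : ℝ, 0 < K ∧ ∀ (𝓙 : Finset ℕ) (blk : ℕ → Finset ℕ) (g : ℕ → ℂ),
      (∀ m n, g (m * n) = g m * g n) → g 1 = 1 → (∀ n, ‖g n‖ ≤ 1) →
      ∀ x T Q ν : ℝ, 3 ≤ x → 4 ≤ T → Real.exp 2 ≤ Q → 1 < ν → ν ≤ 2 → IsBlockSystem 𝓙 blk ⌊ν * x⌋₊ →
      (∀ i ∈ 𝓙, ∀ p ∈ blk i, (p : ℝ) ≤ Q) →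
        ‖S (restr 𝓙 blk g ⌊ν * x⌋₊) (ν * x) - S (restr 𝓙 blk g ⌊ν * x⌋₊) x‖ ≤ K *
          ((ν - 1) * x *
              ((1 + minHalfDistSq (𝓙.biUnion blk) g (ν * x) T) *
                  Real.exp (-minHalfDistSq (𝓙.biUnion blk) g (ν * x) T) +
                1 / T + (𝓙.card + 1) * Real.sqrt ((Real.log Q + 2) / Real.log x)) +
            (𝓙.card + 1) * x * (ν - 1) ^ (-(1 / 12 : ℝ)) / Real.sqrt (Real.log x) +
            x / Real.log x + x / T + (𝓙.biUnion blk).card) := by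
  classical
  obtain ⟨C₂, hC₂⟩ := exists_sum_abs_psi_sub_mul_kk_le
  obtain ⟨Cθ', hCθ'⟩ := Literature.NumberTheory.LFunctions.ChebyshevThetaDeLaValleePoussin_holds.logPow 6
  set Cθ : ℝ := max Cθ' 0 with hCθdef
  have hCθ0 : 0 ≤ Cθ := le_max_right _ _
  have hCθ : ∀ z : ℝ, 2 ≤ z → |θ z - z| ≤ Cθ * z / Real.log z ^ (6 : ℝ) := by
    intro z hz
    refine (hCθ' z hz).trans ?_
    have hlogz : 0 < Real.log z ^ (6 : ℝ) := Real.rpow_pos_of_pos (Real.log_pos (by linarith)) _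
    exact div_le_div_of_nonneg_right (mul_le_mul_of_nonneg_right (le_max_left _ _) (by linarith)) hlogz.le
  set e5 : ℝ := Real.exp 5 with he5
  set e7 : ℝ := Real.exp 7 with he7
  set e12 : ℝ := Real.exp 12 with he12
  set e30 : ℝ := Real.exp 30 with he30
  set KC : ℝ := 1 + (3 * Cθ) ^ (1 / 6 : ℝ) with hKC
  have hKC1 : 1 ≤ KC := by
    have : 0 ≤ (3 * Cθ) ^ (1 / 6 : ℝ) := Real.rpow_nonneg (by positivity) _
    rw [hKC]; linarith
  set cG : ℝ := Real.sqrt (272 * KC) with hcG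
  have hcG0 : 0 ≤ cG := Real.sqrt_nonneg _
  set K : ℝ := 68 * (e30 + e7) + 272 * e5 + 3196 * e5 + 68 * e12 * (e30 + e7) + 4794 * e12 +
    49 * cG * e12 + 140 * e12 + 2312 + 4 * e30 + 2 + (3 * |C₂| + 10) + 4 + e7 + 1 with hK
  have he5pos : 0 < e5 := Real.exp_pos _
  have he7pos : 0 < e7 := Real.exp_pos _
  have he12pos : 0 < e12 := Real.exp_pos _
  have he30pos : 0 < e30 := Real.exp_pos _
  have hKpos : 0 < K := by positivity
  have hKrest : 0 ≤ 68 * (e30 + e7) + 272 * e5 + 3196 * e5 + 68 * e12 * (e30 + e7) + 4794 * e12 +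
      49 * cG * e12 + 140 * e12 + 2312 + 4 * e30 + 2 + (3 * |C₂| + 10) + 4 := by positivity
  have hprod1 : 0 ≤ e12 * e30 := by positivity
  have hprod2 : 0 ≤ e12 * e7 := by positivity
  have hprod3 : 0 ≤ cG * e12 := by positivity
  have hK1 : 1 ≤ K := by rw [hK]; linarith [he7pos.le, hKrest]
  have hKe7 : e7 ≤ K := by rw [hK]; linarith [hKrest]
  refine ⟨K, hKpos, ?_⟩
  intro 𝓙 blk g hg hg1 hgb x T Q ν hx hT hQ hν hν2 hsys hblkQ
  set N : ℕ := ⌊ν * x⌋₊ with hN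
  set a := restr 𝓙 blk g N with ha_def
  have hab : ∀ n, ‖a n‖ ≤ 1 := norm_restr_le_one hgb
  set E := 𝓙.biUnion blk with hE
  set xN : ℝ := ν * x with hxN
  set M : ℝ := minHalfDistSq E g xN T with hM
  set Φ : ℝ := (1 + M) * Real.exp (-M) with hΦ
  set ℓ : ℝ := Real.log x with hℓ
  set ℓN : ℝ := Real.log xN with hℓN
  set m : ℝ := (𝓙.card : ℝ) with hm
  set ρ : ℝ := Real.sqrt ((Real.log Q + 2) / ℓ) with hρ
  set η : ℝ := ν - 1 with hη
  have hx0 : 0 < x := by linarith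
  have hx1 : 1 ≤ x := by linarith
  have hη0 : 0 < η := by rw [hη]; linarith
  have hη1 : η ≤ 1 := by rw [hη]; linarith
  have hxN3 : 3 ≤ xN := by rw [hxN]; nlinarith
  have hxN2x : xN ≤ 2 * x := by rw [hxN]; nlinarith
  have hℓ1 : 1 < ℓ := by
    rw [hℓ, ← Real.log_exp 1]
    exact Real.log_lt_log (Real.exp_pos 1) (by have := Real.exp_one_lt_d9; linarith)
  have hℓ0 : 0 < ℓ := by linarith
  have hlog2 : Real.log 2 < 1 := by have := Real.log_two_lt_d9; linarith
  have hℓN : ℓ ≤ ℓN := Real.log_le_log hx0 (by rw [hxN]; nlinarith)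
  have hℓN2 : ℓN ≤ 2 * ℓ := by
    calc ℓN ≤ Real.log (2 * x) := Real.log_le_log (by linarith) hxN2x
      _ = Real.log 2 + ℓ := by rw [Real.log_mul (by norm_num) hx0.ne', hℓ]
      _ ≤ 2 * ℓ := by linarith
  have hℓN0 : 0 < ℓN := by linarith
  have hT0 : 0 < T := by linarith
  have hQ0 : 0 < Q := lt_of_lt_of_le (Real.exp_pos 2) hQ
  have hlogQ2 : 2 ≤ Real.log Q := by
    rw [← Real.log_exp 2]; exact Real.log_le_log (Real.exp_pos 2) hQ
  have hM0 : 0 ≤ M := minHalfDistSq_nonneg hgb E xN (by linarith)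
  have hMll : M ≤ Real.log ℓN + 30 := minHalfDistSq_le_loglog hgb E hxN3 (by linarith)
  have heM : 0 < Real.exp (-M) := Real.exp_pos _
  have hΦ0 : 0 ≤ Φ := by positivity
  have hm0 : 0 ≤ m := Nat.cast_nonneg _
  have hρ0 : 0 ≤ ρ := Real.sqrt_nonneg _
  have hll0 : 0 ≤ Real.log ℓ := Real.log_nonneg hℓ1.le
  have hcard0 : (0 : ℝ) ≤ E.card := Nat.cast_nonneg _
  -- the target, split into its summands
  set R₁ : ℝ := η * x * (Φ + 1 / T + (m + 1) * ρ) with hR₁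
  set R₂ : ℝ := (m + 1) * x * η ^ (-(1 / 12 : ℝ)) / Real.sqrt ℓ with hR₂
  set Rtot : ℝ := R₁ + R₂ + x / ℓ + x / T + E.card with hRtot
  have hηpow1 : 1 ≤ η ^ (-(1 / 12 : ℝ)) := by
    rw [Real.rpow_neg hη0.le, one_le_inv_iff₀]
    exact ⟨Real.rpow_pos_of_pos hη0 _, Real.rpow_le_one hη0.le hη1 (by norm_num)⟩
  have hR₁0 : 0 ≤ R₁ := by positivity
  have hR₂0 : 0 ≤ R₂ := by positivity
  have hxℓ1 : 1 ≤ x / ℓ := by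
    rw [le_div_iff₀ hℓ0, one_mul, hℓ]
    have := Real.log_le_sub_one_of_pos hx0; linarith
  have hRtot0 : 0 ≤ Rtot := by positivity
  have hRtot1 : 1 ≤ Rtot := by
    have : 0 ≤ x / T := by positivity
    linarith
  -- the trivial bound
  have hS0 : ‖Sh a ν x‖ ≤ η * x + 1 := norm_Sh_le' hab hν.le hx0.le
  have hgoal : ∀ {c : ℝ}, 0 < c → c ≤ K → η * x ≤ c * R₁ →
      ‖S a (ν * x) - S a x‖ ≤ K * Rtot := by
    intro c hc hcK hηx
    have h1 : ‖Sh a ν x‖ ≤ c * R₁ + 1 := by linarith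
    have h2 : c * R₁ + 1 ≤ K * Rtot := by
      have : c * R₁ ≤ K * R₁ := mul_le_mul_of_nonneg_right hcK hR₁0
      have h3 : K * R₁ + K * 1 ≤ K * Rtot := by
        rw [← mul_add]; refine mul_le_mul_of_nonneg_left ?_ hKpos.le
        have : 0 ≤ x / T := by positivity
        linarith
      linarith
    exact h1.trans h2
  -- trivial case `ρ > 1`
  by_cases hρ1 : 1 < ρ
  · refine hgoal one_pos hK1 ?_
    have h1 : 1 ≤ (m + 1) * ρ := by
      have := mul_le_mul_of_nonneg_right (by linarith : (1:ℝ) ≤ m + 1) hρ0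
      linarith
    have h2 : 1 ≤ Φ + 1 / T + (m + 1) * ρ := by
      have : 0 ≤ 1 / T := by positivity
      linarith
    calc η * x = η * x * 1 := (mul_one _).symm
      _ ≤ η * x * (Φ + 1 / T + (m + 1) * ρ) := mul_le_mul_of_nonneg_left h2 (by positivity)
      _ = 1 * R₁ := by rw [hR₁]; ring
  push Not at hρ1
  -- trivial case `M < 7`
  by_cases hM7 : M < 7
  · have hΦ7 : 8 * Real.exp (-7) ≤ Φ := by
      have := Tao2016.one_add_mul_exp_neg_le hM0 hM7.le
      norm_num at this ⊢
      linarith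
    have h77 : e7 * Real.exp (-7) = 1 := by rw [he7, ← Real.exp_add]; simp
    refine hgoal (c := e7 / 8) (by positivity) (by linarith) ?_
    have h2 : 8 * Real.exp (-7) ≤ Φ + 1 / T + (m + 1) * ρ := by
      have : 0 ≤ 1 / T + (m + 1) * ρ := by positivity
      linarith
    calc η * x = e7 / 8 * (η * x * (8 * Real.exp (-7))) := by
          rw [show e7 / 8 * (η * x * (8 * Real.exp (-7))) = (e7 * Real.exp (-7)) * (η * x) by ring, h77, one_mul]
      _ ≤ e7 / 8 * (η * x * (Φ + 1 / T + (m + 1) * ρ)) := by gcongr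
      _ = e7 / 8 * R₁ := by rw [hR₁]
  push Not at hM7
  -- the main case `M ≥ 7`, `ρ ≤ 1`
  set Bw : ℝ := e7 * ℓN * Real.exp (-M) with hBw
  have hBw0 : 0 < Bw := by positivity
  have heM7 : Real.exp (-M) ≤ Real.exp (-7) := Real.exp_le_exp.2 (by linarith)
  have h77 : e7 * Real.exp (-7) = 1 := by rw [he7, ← Real.exp_add]; simp
  have hL1 : e7 * Real.exp (-M) ≤ 1 := by
    calc e7 * Real.exp (-M) ≤ e7 * Real.exp (-7) := by gcongr
      _ = 1 := h77
  have hBwℓ : Bw ≤ ℓN := by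
    calc Bw = (e7 * Real.exp (-M)) * ℓN := by rw [hBw]; ring
      _ ≤ 1 * ℓN := by gcongr
      _ = ℓN := one_mul ℓN
  set α₀ : ℝ := 1 / (2 * ℓ) with hα₀
  set α₁ : ℝ := min 1 (1 / Bw) with hα₁
  have hα₀0 : 0 < α₀ := by positivity
  have hα₀1 : α₀ ≤ 1 := by rw [hα₀, div_le_one (by positivity)]; linarith only [hℓ1]
  have h1 : α₁ ≤ 1 := min_le_left _ _
  have h01 : α₀ ≤ α₁ := by
    refine le_min hα₀1 ?_
    rw [hα₀]; exact one_div_le_one_div_of_le hBw0 (by linarith only [hBwℓ, hℓN2])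
  have hα₁0 : 0 < α₁ := hα₀0.trans_le h01
  -- Mertens for the `E`-term
  set L : ℝ := Real.log Q + Real.log 4 with hLdef
  have hEsub : E ⊆ Nat.primesLE ⌊Q⌋₊ := by
    intro p hp
    rw [hE, Finset.mem_biUnion] at hp
    obtain ⟨i, hi, hpi⟩ := hp
    rw [Nat.mem_primesLE]
    exact ⟨Nat.le_floor (hblkQ i hi p hpi), hsys.prime_of_mem hi hpi⟩
  have hL : ∑ p ∈ E, Real.log p / p ≤ L := by
    have h1 : ∑ p ∈ E, Real.log p / p ≤ ∑ p ∈ Nat.primesLE ⌊Q⌋₊, Real.log p / p :=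
      Finset.sum_le_sum_of_subset_of_nonneg hEsub fun p hp _ => by
        rw [Nat.mem_primesLE] at hp
        exact div_nonneg (Real.log_nonneg (by exact_mod_cast hp.2.one_lt.le)) (Nat.cast_nonneg p)
    refine h1.trans ((MertensBound.sum_log_div_prime_le ⌊Q⌋₊).trans ?_)
    rw [hLdef]
    gcongr
    · exact Nat.cast_pos.mpr (Nat.floor_pos.mpr (by linarith only [hQ, Real.add_one_le_exp (2:ℝ)]))
    · exact Nat.floor_le hQ0.le
  have hlog4 : Real.log 4 ≤ 2 := by
    have h2 : Real.log 4 = 2 * Real.log 2 := by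
      rw [show (4:ℝ) = 2 ^ 2 by norm_num, Real.log_pow]; ring
    rw [h2]; linarith only [Real.log_two_lt_d9]
  have hL0 : 0 ≤ L := by
    rw [hLdef]; have := Real.log_nonneg (show (1:ℝ) ≤ 4 by norm_num); linarith only [this, hlogQ2]
  -- Lemma A2 and the `α`-representation
  have hII := norm_Sh_restr_mul_log_le_integral hC₂ hsys hg hgb hL hν.le hν2 hx
  have hB1 := integral_normShExp_le (a := a) hab (N := N) (fun n => mulLog_restr_apply n) hν.le hν2 hx
  set Iα : ℝ → ℝ := fun α => ∫ u in Set.Ioc (Real.log 2) (Real.log x),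
    ‖psum (mulLog a N) (ν * Real.exp u) - psum (mulLog a N) (Real.exp u)‖ * Real.exp (-((1 + 2 * α) * u)) with hI
  have hIint : IntegrableOn Iα (Set.Ioc α₀ 1) :=
    (integrable_kernelSh hab N (x := x) hx1 hα₀0.le hν.le hν2).integral_prod_left
  -- the extra terms
  set G : ℝ := 16 * uPNT Cθ ν + 256 with hG
  have hu₁1 : 1 ≤ uPNT Cθ ν := one_le_uPNT hCθ0 hν
  have hG0 : 0 ≤ G := by rw [hG]; linarith
  set F : ℝ := e12 * (Real.sqrt G + m * Real.sqrt (8 * η ^ 2 * Real.log Q + G)) with hF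
  set Gh : ℝ := 32 / Real.sqrt (T / 2) + 90 / (T / 2) with hGh
  have hF0 : 0 ≤ F := by positivity
  have hGh0 : 0 ≤ Gh := by positivity
  set X : ℝ → ℝ := fun α => F / (α * Real.sqrt α) + Gh / Real.sqrt α with hX
  obtain ⟨hXint, hXle⟩ := setIntegral_extra_le (F := F) (G := Gh) hα₀0 hα₀1 hF0 hGh0
  -- the two per-`α` bounds
  have hT22 : 2 * (T / 2) = T := by ring
  have hT21 : (1 : ℝ) ≤ T / 2 := by linarith only [hT]
  have hcrude : ∀ {α : ℝ}, 0 < α → α ≤ 1 → ∀ y : ℝ, ‖LSeries a (1 + α + y * I)‖ ≤ e12 / α := by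
    intro α hα0' hα1' y
    refine (norm_LSeries_restr_le_min hsys hg hg1 hgb hxN3 hα0' hα1' y).trans ?_
    rw [he12]
    calc Real.exp 12 * min (Real.log xN) (1 / α) ≤ Real.exp 12 * (1 / α) := by
          gcongr; exact min_le_right _ _
      _ = Real.exp 12 / α := by ring
  have hb1 : ∀ α ∈ Set.Icc α₀ α₁, Iα α - X α ≤ 2 * η * Bw / α + 8 * η * e5 * ℓN / T + (94 * e5 / T) / α ^ 2 := by
    intro α hα
    have hα0' : 0 < α := hα₀0.trans_le hα.1
    have hα1' : α ≤ 1 := hα.2.trans h1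
    set B : ℝ := min (e12 / α) (Bw + 2 * α / (T / 2) * (e5 * ℓN)) with hBdef
    have hB0 : 0 ≤ B := le_min (by positivity) (by positivity)
    have hBle : B ≤ Real.exp 12 / α := by rw [hBdef, he12]; exact min_le_left _ _
    have hBwin : ∀ y : ℝ, |y| ≤ T / 2 → ‖LSeries a (1 + α + y * I)‖ ≤ B := by
      intro y hy
      refine le_min (hcrude hα0' hα1' y) ?_
      have h := norm_LSeries_restr_shift_le hsys hg hg1 hgb hxN3 hα0' (T₀ := T / 2) (by linarith only [hT]) hy
      rw [hT22] at h
      exact h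
    have hB := inner_integral_restr_interval_le hsys hg hg1 hgb hxN3 hx1 hCθ0 hCθ hα0' hα1' hT21 hQ hblkQ
      hν hν2 hB0 hBle hBwin
    have hXα : X α = e12 * (Real.sqrt G + m * Real.sqrt (8 * η ^ 2 * Real.log Q + G)) / (α * Real.sqrt α) +
        (32 / Real.sqrt (T / 2) + 90 / (T / 2)) / Real.sqrt α := by
      simp only [hX, hF, hGh]
    have hmain : 2 * (ν - 1) * B / α ≤ 2 * η * Bw / α + 8 * η * e5 * ℓN / T := by
      have h1 : B ≤ Bw + 2 * α / (T / 2) * (e5 * ℓN) := min_le_right _ _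
      have h2 : 2 * (ν - 1) * B / α ≤ 2 * (ν - 1) * (Bw + 2 * α / (T / 2) * (e5 * ℓN)) / α :=
        div_le_div_of_nonneg_right (mul_le_mul_of_nonneg_left h1 (by linarith only [hν])) hα0'.le
      have e : 2 * (ν - 1) * (Bw + 2 * α / (T / 2) * (e5 * ℓN)) / α = 2 * η * Bw / α + 8 * η * e5 * ℓN / T := by
        rw [hη]; field_simp; ring
      linarith only [e, h2]
    have htail : 47 * Real.exp 5 / (α ^ 2 * (T / 2)) = (94 * e5 / T) / α ^ 2 := by
      rw [he5]; field_simp; ring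
    simp only [hI]
    rw [hm, hη, hG, he12] at hXα
    linarith only [hB, hXα, hmain, htail]
  have hb2 : ∀ α ∈ Set.Icc α₁ 1, Iα α - X α ≤ (2 * η * e12 + 94 * e5 / T) / α ^ 2 := by
    intro α hα
    have hα0' : 0 < α := hα₁0.trans_le hα.1
    have hα1' : α ≤ 1 := hα.2
    have hB := inner_integral_restr_interval_le hsys hg hg1 hgb hxN3 hx1 hCθ0 hCθ hα0' hα1' hT21 hQ hblkQ
      hν hν2 (B := e12 / α) (by positivity) (by rw [he12]) (fun y _ => hcrude hα0' hα1' y)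
    have hXα : X α = e12 * (Real.sqrt G + m * Real.sqrt (8 * η ^ 2 * Real.log Q + G)) / (α * Real.sqrt α) +
        (32 / Real.sqrt (T / 2) + 90 / (T / 2)) / Real.sqrt α := by
      simp only [hX, hF, hGh]
    have hmain : 2 * (ν - 1) * (e12 / α) / α = 2 * η * e12 / α ^ 2 := by rw [hη]; field_simp
    have htail : 47 * Real.exp 5 / (α ^ 2 * (T / 2)) = (94 * e5 / T) / α ^ 2 := by
      rw [he5]; field_simp; ring
    have e : 2 * η * e12 / α ^ 2 + (94 * e5 / T) / α ^ 2 = (2 * η * e12 + 94 * e5 / T) / α ^ 2 := by ring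
    simp only [hI]
    rw [hm, hη, hG, he12] at hXα
    linarith only [hB, hXα, hmain, htail, e]
  have hĨint : IntegrableOn (fun α => Iα α - X α) (Set.Ioc α₀ 1) := hIint.sub hXint
  have hB3 := setIntegral_le_of_two_regimes hα₀0 h01 h1 hĨint (P := 2 * η * Bw)
    (c := 8 * η * e5 * ℓN / T) (E := 94 * e5 / T) (Q := 2 * η * e12 + 94 * e5 / T) (by positivity) (by positivity)
    (by positivity) hb1 hb2
  have hIsplit : ∫ α in Set.Ioc α₀ 1, Iα α = (∫ α in Set.Ioc α₀ 1, (Iα α - X α)) + ∫ α in Set.Ioc α₀ 1, X α := by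
    rw [← integral_add hĨint hXint]
    exact integral_congr_ae (Filter.Eventually.of_forall fun α => by simp only [hX]; ring)
  have hXle' : ∫ α in Set.Ioc α₀ 1, X α ≤ 2 * F * Real.sqrt (2 * ℓ) + 2 * Gh := by
    refine hXle.trans (le_of_eq ?_)
    rw [hα₀, Real.sqrt_div' 1 (by positivity : (0:ℝ) ≤ 2 * ℓ), Real.sqrt_one]
    field_simp
  -- the units of the bound
  have hΦℓ : (1 + Real.log ℓN) ≤ e30 * Φ * ℓN := by
    have hA : (1 + Real.log ℓN) / ℓN ≤ e30 * Φ := one_add_loglog_div_le hxN3 hM0 hMll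
    rwa [div_le_iff₀ hℓN0] at hA
  have hlogℓN0 : 0 ≤ Real.log ℓN := Real.log_nonneg (by linarith)
  have hΦℓ2 : e30 * Φ * ℓN ≤ 2 * e30 * Φ * ℓ := by
    have := mul_le_mul_of_nonneg_left hℓN2 (by positivity : 0 ≤ e30 * Φ)
    linarith only [this]
  have hone : 1 ≤ 2 * e30 * Φ * ℓ := by linarith only [hΦℓ, hlogℓN0, hΦℓ2]
  have hlogℓ : 1 + Real.log ℓ ≤ 2 * e30 * Φ * ℓ := by
    have : Real.log ℓ ≤ Real.log ℓN := Real.log_le_log hℓ0 hℓN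
    linarith only [this, hΦℓ, hΦℓ2]
  have hBwle : Bw ≤ 2 * e7 * Φ * ℓ := by
    have hMe : Real.exp (-M) ≤ Φ := by
      have := mul_le_mul_of_nonneg_right (by linarith only [hM0] : (1:ℝ) ≤ 1 + M) heM.le
      rw [hΦ]; linarith only [this]
    calc Bw = e7 * (Real.exp (-M) * ℓN) := by rw [hBw]; ring
      _ ≤ e7 * (Φ * (2 * ℓ)) := by gcongr
      _ = 2 * e7 * Φ * ℓ := by ring
  -- t1: `17 · 2ηBw log(α₁/α₀) · x ≤ 68 (e30 + e7) ηxΦℓ`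
  have ht1 : 17 * (2 * η * Bw * Real.log (α₁ / α₀)) * x ≤ 68 * (e30 + e7) * (η * x * Φ * ℓ) := by
    have hkey : Bw * Real.log (α₁ / α₀) ≤ 2 * (e30 + e7) * Φ * ℓ := by
      rcases le_or_gt Bw 1 with hB1 | hB1
      · have hα₁1 : α₁ = 1 := min_eq_left (by rw [le_one_div (by norm_num) hBw0]; simpa using hB1)
        have hlog : Real.log (α₁ / α₀) = Real.log 2 + Real.log ℓ := by
          rw [hα₁1, hα₀, one_div_one_div]
          exact Real.log_mul (by norm_num) hℓ0.ne'
        rw [hlog]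
        have hlog0 : 0 ≤ Real.log 2 + Real.log ℓ := by
          have := Real.log_pos (show (1:ℝ) < 2 by norm_num); linarith only [this, hll0]
        have hpos7 : 0 ≤ e7 * Φ * ℓ := by positivity
        calc Bw * (Real.log 2 + Real.log ℓ) ≤ 1 * (1 + Real.log ℓ) :=
              mul_le_mul hB1 (by linarith only [hlog2]) hlog0 zero_le_one
          _ ≤ 2 * e30 * Φ * ℓ := by linarith only [hlogℓ]
          _ ≤ 2 * (e30 + e7) * Φ * ℓ := by linarith only [hpos7]
      · have hα₁B : α₁ = 1 / Bw := min_eq_right (by rw [div_le_one hBw0]; exact hB1.le)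
        have hlog : Real.log (α₁ / α₀) ≤ M := by
          have hq : α₁ / α₀ = 2 * ℓ * Real.exp M / (e7 * ℓN) := by
            rw [hα₁B, hα₀, hBw, Real.exp_neg]
            field_simp
          have hq2 : 2 * ℓ * Real.exp M / (e7 * ℓN) ≤ 2 * Real.exp M / e7 := by
            rw [div_le_div_iff₀ (by positivity) he7pos]
            have := mul_le_mul_of_nonneg_left hℓN (by positivity : (0:ℝ) ≤ 2 * Real.exp M * e7)
            linarith only [this]
          have hpos : 0 < α₁ / α₀ := by positivity
          calc Real.log (α₁ / α₀) ≤ Real.log (2 * Real.exp M / e7) := by rw [hq] at hpos ⊢; exact Real.log_le_log hpos hq2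
            _ = Real.log 2 + M - 7 := by
                rw [Real.log_div (by positivity) he7pos.ne', Real.log_mul (by norm_num) (Real.exp_pos M).ne',
                  Real.log_exp, he7, Real.log_exp]
            _ ≤ M := by linarith only [hlog2]
        have hlog0 : 0 ≤ Real.log (α₁ / α₀) := Real.log_nonneg (by
          rw [le_div_iff₀ hα₀0, one_mul]; exact h01)
        have hMΦ : M * Real.exp (-M) ≤ Φ := by
          have : Φ = M * Real.exp (-M) + Real.exp (-M) := by rw [hΦ]; ring
          rw [this]; linarith only [heM]
        have hpos30 : 0 ≤ e30 * Φ * ℓ := by positivity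
        calc Bw * Real.log (α₁ / α₀) ≤ Bw * M := mul_le_mul_of_nonneg_left hlog hBw0.le
          _ = e7 * ℓN * (M * Real.exp (-M)) := by rw [hBw]; ring
          _ ≤ e7 * (2 * ℓ) * Φ := by gcongr
          _ = 2 * e7 * Φ * ℓ := by ring
          _ ≤ 2 * (e30 + e7) * Φ * ℓ := by linarith only [hpos30]
    calc 17 * (2 * η * Bw * Real.log (α₁ / α₀)) * x = 34 * η * x * (Bw * Real.log (α₁ / α₀)) := by ring
      _ ≤ 34 * η * x * (2 * (e30 + e7) * Φ * ℓ) := mul_le_mul_of_nonneg_left hkey (by positivity)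
      _ = 68 * (e30 + e7) * (η * x * Φ * ℓ) := by ring
  -- t2: `17 x c ≤ 272 e5 ηxℓ/T`
  have ht2 : 17 * (8 * η * e5 * ℓN / T) * x ≤ 272 * e5 * (η * x * ℓ / T) := by
    have h1 : 8 * η * e5 * ℓN / T ≤ 8 * η * e5 * (2 * ℓ) / T := by gcongr
    calc 17 * (8 * η * e5 * ℓN / T) * x = (8 * η * e5 * ℓN / T) * (17 * x) := by ring
      _ ≤ (8 * η * e5 * (2 * ℓ) / T) * (17 * x) := mul_le_mul_of_nonneg_right h1 (by positivity)
      _ = 272 * e5 * (η * x * ℓ / T) := by ring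
  -- t3: `17 x E/α₀ = 3196 e5 xℓ/T`
  have ht3 : 17 * ((94 * e5 / T) / α₀) * x = 3196 * e5 * (x * ℓ / T) := by
    rw [hα₀]; field_simp; ring
  -- t4: `17 x Q'/α₁ ≤ 68 e12 (e30+e7) ηxΦℓ + 4794 e12 xℓ/T`
  have ht4 : 17 * ((2 * η * e12 + 94 * e5 / T) / α₁) * x ≤
      68 * e12 * (e30 + e7) * (η * x * Φ * ℓ) + 4794 * e12 * (x * ℓ / T) := by
    have hinv : 1 / α₁ ≤ 1 + Bw := one_div_min_le hBw0
    have h1B : 1 + Bw ≤ 2 * (e30 + e7) * Φ * ℓ := by linarith only [hone, hBwle]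
    have he71 : (1:ℝ) ≤ e7 := by rw [he7]; have := Real.add_one_le_exp (7:ℝ); linarith only [this]
    have h1B' : 1 + Bw ≤ 3 * e7 * ℓ := by
      have : Bw ≤ e7 * (2 * ℓ) := by
        calc Bw ≤ ℓN := hBwℓ
          _ ≤ 2 * ℓ := hℓN2
          _ ≤ e7 * (2 * ℓ) := le_mul_of_one_le_left (by linarith only [hℓ0]) he71
      have h7 : (1:ℝ) ≤ e7 * ℓ := one_le_mul_of_one_le_of_one_le he71 hℓ1.le
      linarith only [this, h7]
    have hsplit : 17 * ((2 * η * e12 + 94 * e5 / T) / α₁) * x =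
        17 * (2 * η * e12) * x * (1 / α₁) + 17 * (94 * e5 / T) * x * (1 / α₁) := by ring
    rw [hsplit]
    have hA : 17 * (2 * η * e12) * x * (1 / α₁) ≤ 68 * e12 * (e30 + e7) * (η * x * Φ * ℓ) := by
      calc 17 * (2 * η * e12) * x * (1 / α₁) ≤ 17 * (2 * η * e12) * x * (2 * (e30 + e7) * Φ * ℓ) :=
            mul_le_mul_of_nonneg_left (hinv.trans h1B) (by positivity)
        _ = 68 * e12 * (e30 + e7) * (η * x * Φ * ℓ) := by ring
    have hB : 17 * (94 * e5 / T) * x * (1 / α₁) ≤ 4794 * e12 * (x * ℓ / T) := by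
      calc 17 * (94 * e5 / T) * x * (1 / α₁) ≤ 17 * (94 * e5 / T) * x * (3 * e7 * ℓ) :=
            mul_le_mul_of_nonneg_left (hinv.trans h1B') (by positivity)
        _ = 4794 * (e5 * e7) * (x * ℓ / T) := by ring
        _ = 4794 * e12 * (x * ℓ / T) := by rw [he5, he7, he12, ← Real.exp_add]; norm_num
    linarith only [hA, hB]
  -- t5: `17 x · 2F√(2ℓ) ≤ 49 cG e12 (m+1) x η^{-1/12} √ℓ + 140 e12 ηx m ρ ℓ`
  have ht5 : 17 * (2 * F * Real.sqrt (2 * ℓ)) * x ≤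
      49 * cG * e12 * ((m + 1) * x * η ^ (-(1 / 12 : ℝ)) * Real.sqrt ℓ) + 140 * e12 * (η * x * m * (ρ * ℓ)) := by
    have hs2 : Real.sqrt 2 ≤ 1.42 := by
      rw [Real.sqrt_le_left (by norm_num)]; norm_num
    have hs8 : Real.sqrt 8 ≤ 2.83 := by
      rw [Real.sqrt_le_left (by norm_num)]; norm_num
    have hsplit : Real.sqrt (2 * ℓ) = Real.sqrt 2 * Real.sqrt ℓ := Real.sqrt_mul (by norm_num) ℓ
    have hsl0 : 0 < Real.sqrt ℓ := Real.sqrt_pos.mpr hℓ0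
    -- `√G ≤ cG η^{-1/12}`
    have hGle : G ≤ 272 * KC * η ^ (-(1 / 6 : ℝ)) := by
      have hu := uPNT_le hCθ0 hν hν2
      rw [← hKC, ← hη] at hu
      have h16 : 16 * uPNT Cθ ν ≤ 16 * (KC * η ^ (-(1 / 6 : ℝ))) := by linarith only [hu]
      have h256 : (256 : ℝ) ≤ 256 * (KC * η ^ (-(1 / 6 : ℝ))) := by
        have hpow : 1 ≤ η ^ (-(1 / 6 : ℝ)) := by
          rw [Real.rpow_neg hη0.le, one_le_inv_iff₀]
          exact ⟨Real.rpow_pos_of_pos hη0 _, Real.rpow_le_one hη0.le hη1 (by norm_num)⟩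
        have := one_le_mul_of_one_le_of_one_le hKC1 hpow
        linarith only [this]
      rw [hG]; linarith only [h16, h256]
    have hsqrtG : Real.sqrt G ≤ cG * η ^ (-(1 / 12 : ℝ)) := by
      have e1 : η ^ (-(1 / 6 : ℝ)) = (η ^ (-(1 / 12 : ℝ))) ^ 2 := by
        rw [← Real.rpow_natCast, ← Real.rpow_mul hη0.le]; norm_num
      have hpos : 0 ≤ η ^ (-(1 / 12 : ℝ)) := Real.rpow_nonneg hη0.le _
      calc Real.sqrt G ≤ Real.sqrt (272 * KC * η ^ (-(1 / 6 : ℝ))) := Real.sqrt_le_sqrt hGle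
        _ = cG * η ^ (-(1 / 12 : ℝ)) := by
            rw [e1, Real.sqrt_mul (by positivity), Real.sqrt_sq hpos, hcG]
    -- `√(8η² log Q + G) ≤ η √8 √(log Q + 2) + √G`
    have hsqrtW : Real.sqrt (8 * η ^ 2 * Real.log Q + G) ≤ 2.83 * η * Real.sqrt (Real.log Q + 2) + Real.sqrt G := by
      have h1 : Real.sqrt (8 * η ^ 2 * Real.log Q + G) ≤ Real.sqrt (8 * η ^ 2 * Real.log Q) + Real.sqrt G :=
        sqrt_add_le' (by positivity) hG0
      have h2 : Real.sqrt (8 * η ^ 2 * Real.log Q) ≤ 2.83 * η * Real.sqrt (Real.log Q + 2) := by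
        rw [show 8 * η ^ 2 * Real.log Q = (8 * η ^ 2) * Real.log Q by ring,
          Real.sqrt_mul (by positivity), Real.sqrt_mul (by norm_num), Real.sqrt_sq hη0.le]
        have : Real.sqrt (Real.log Q) ≤ Real.sqrt (Real.log Q + 2) := Real.sqrt_le_sqrt (by linarith)
        have h3 : Real.sqrt 8 * η * Real.sqrt (Real.log Q) ≤ 2.83 * η * Real.sqrt (Real.log Q + 2) :=
          mul_le_mul (mul_le_mul_of_nonneg_right hs8 hη0.le) this (Real.sqrt_nonneg _) (by positivity)
        linarith only [h3]
      linarith only [h1, h2]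
    have hρℓ : Real.sqrt (Real.log Q + 2) * Real.sqrt ℓ = ρ * ℓ := by
      rw [hρ, Real.sqrt_div' _ hℓ0.le, div_mul_eq_mul_div, eq_div_iff hsl0.ne']
      calc Real.sqrt (Real.log Q + 2) * Real.sqrt ℓ * Real.sqrt ℓ
          = Real.sqrt (Real.log Q + 2) * (Real.sqrt ℓ * Real.sqrt ℓ) := by ring
        _ = Real.sqrt (Real.log Q + 2) * ℓ := by rw [Real.mul_self_sqrt hℓ0.le]
    -- `F ≤ e12 ((m+1) √G + 2.83 m η √(log Q+2))`
    have hFle : F ≤ e12 * ((m + 1) * (cG * η ^ (-(1 / 12 : ℝ))) + 2.83 * m * η * Real.sqrt (Real.log Q + 2)) := by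
      rw [hF]
      refine mul_le_mul_of_nonneg_left ?_ he12pos.le
      have h1 : m * Real.sqrt (8 * η ^ 2 * Real.log Q + G) ≤ m * (2.83 * η * Real.sqrt (Real.log Q + 2) + Real.sqrt G) :=
        mul_le_mul_of_nonneg_left hsqrtW hm0
      have h2 := mul_le_mul_of_nonneg_left hsqrtG hm0
      linarith only [hsqrtG, h1, h2]
    calc 17 * (2 * F * Real.sqrt (2 * ℓ)) * x = 34 * x * F * (Real.sqrt 2 * Real.sqrt ℓ) := by rw [hsplit]; ring
      _ ≤ 34 * x * (e12 * ((m + 1) * (cG * η ^ (-(1 / 12 : ℝ))) + 2.83 * m * η * Real.sqrt (Real.log Q + 2))) *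
            (1.42 * Real.sqrt ℓ) := by
          refine mul_le_mul (mul_le_mul_of_nonneg_left hFle (by positivity))
            (mul_le_mul_of_nonneg_right hs2 (Real.sqrt_nonneg ℓ)) (by positivity) (by positivity)
      _ = 34 * 1.42 * e12 * cG * ((m + 1) * x * η ^ (-(1 / 12 : ℝ)) * Real.sqrt ℓ) +
            34 * 1.42 * 2.83 * e12 * (η * x * m * (Real.sqrt (Real.log Q + 2) * Real.sqrt ℓ)) := by ring
      _ ≤ 49 * cG * e12 * ((m + 1) * x * η ^ (-(1 / 12 : ℝ)) * Real.sqrt ℓ) + 140 * e12 * (η * x * m * (ρ * ℓ)) := by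
          rw [hρℓ]
          have hA0 : 0 ≤ cG * e12 * ((m + 1) * x * η ^ (-(1 / 12 : ℝ)) * Real.sqrt ℓ) := by positivity
          have hB0 : 0 ≤ e12 * (η * x * m * (ρ * ℓ)) := by positivity
          linarith only [hA0, hB0]
  -- t6: `17 x · 2Gh ≤ 2312 x`
  have ht6 : 17 * (2 * Gh) * x ≤ 2312 * x := by
    have hGh68 : Gh ≤ 68 := by
      rw [hGh]
      have hs : Real.sqrt 2 ≤ Real.sqrt (T / 2) := Real.sqrt_le_sqrt (by linarith only [hT])
      have hs2 : (1.4 : ℝ) ≤ Real.sqrt 2 := by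
        rw [Real.le_sqrt (by norm_num) (by norm_num)]; norm_num
      have h1 : 32 / Real.sqrt (T / 2) ≤ 32 / 1.4 := div_le_div_of_nonneg_left (by norm_num) (by norm_num) (hs2.trans hs)
      have h2 : 90 / (T / 2) ≤ 45 := by rw [div_le_iff₀ (by linarith only [hT])]; linarith only [hT]
      have h3 : (32 : ℝ) / 1.4 ≤ 23 := by norm_num
      linarith only [h1, h2, h3]
    have := mul_le_mul_of_nonneg_right hGh68 hx0.le
    linarith only [this]
  -- t7: `x η (log ℓ + 2) ≤ 4 e30 ηxΦℓ`
  have ht7 : x * (η * (Real.log ℓ + 2)) ≤ 4 * e30 * (η * x * Φ * ℓ) := by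
    have h1 : Real.log ℓ + 2 ≤ 2 * (1 + Real.log ℓ) := by linarith only [hll0]
    have h2 : Real.log ℓ + 2 ≤ 4 * e30 * Φ * ℓ := by linarith only [h1, hlogℓ]
    calc x * (η * (Real.log ℓ + 2)) = (x * η) * (Real.log ℓ + 2) := by ring
      _ ≤ (x * η) * (4 * e30 * Φ * ℓ) := mul_le_mul_of_nonneg_left h2 (by positivity)
      _ = 4 * e30 * (η * x * Φ * ℓ) := by ring
  -- t8: `2L ηx ≤ 2 ηx (m+1) ρ ℓ` (using `ρ ≤ 1`)
  have ht8 : 2 * L * ((ν - 1) * x) ≤ 2 * (η * x * (m + 1) * (ρ * ℓ)) := by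
    have hL2 : L ≤ Real.log Q + 2 := by rw [hLdef]; linarith only [hlog4]
    have hρ2 : ρ ^ 2 = (Real.log Q + 2) / ℓ := by rw [hρ]; exact Real.sq_sqrt (by positivity)
    have hρℓ' : Real.log Q + 2 = ρ ^ 2 * ℓ := by rw [hρ2]; field_simp
    have hρρ : ρ ^ 2 ≤ ρ := by nlinarith only [hρ0, hρ1]
    have h3 : ρ ^ 2 * ℓ ≤ ρ * ℓ := mul_le_mul_of_nonneg_right hρρ hℓ0.le
    have h4 : ρ * ℓ ≤ (m + 1) * (ρ * ℓ) := le_mul_of_one_le_left (by positivity) (by linarith only [hm0])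
    rw [← hη]
    calc 2 * L * (η * x) ≤ 2 * (Real.log Q + 2) * (η * x) := by gcongr
      _ = 2 * (η * x) * (ρ ^ 2 * ℓ) := by rw [hρℓ']; ring
      _ ≤ 2 * (η * x) * ((m + 1) * (ρ * ℓ)) := by
          refine mul_le_mul_of_nonneg_left (h3.trans h4) (by positivity)
      _ = 2 * (η * x * (m + 1) * (ρ * ℓ)) := by ring
  -- t9: `2 |E| log(νx) ≤ 4 |E| ℓ`
  have ht9 : 2 * (E.card : ℝ) * Real.log (ν * x) ≤ 4 * (E.card * ℓ) := by
    have h1 : Real.log (ν * x) ≤ 2 * ℓ := hℓN2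
    have := mul_le_mul_of_nonneg_left h1 hcard0
    linarith only [this]
  -- assemble
  have hmain : ‖Sh a ν x‖ * ℓ ≤ K * Rtot * ℓ := by
    -- the `α`-integral
    have hIle : ∫ α in Set.Ioc α₀ 1, Iα α ≤
        2 * η * Bw * Real.log (α₁ / α₀) + 8 * η * e5 * ℓN / T + (94 * e5 / T) / α₀ +
          (2 * η * e12 + 94 * e5 / T) / α₁ + (2 * F * Real.sqrt (2 * ℓ) + 2 * Gh) := by
      rw [hIsplit]; linarith only [hB3, hXle']
    -- the units
    set U1 : ℝ := η * x * Φ * ℓ with hU1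
    set U2 : ℝ := η * x * ℓ / T with hU2
    set U3 : ℝ := η * x * (m + 1) * (ρ * ℓ) with hU3
    set U4 : ℝ := (m + 1) * x * η ^ (-(1 / 12 : ℝ)) * Real.sqrt ℓ with hU4
    set U5 : ℝ := x * ℓ / T with hU5
    set U6 : ℝ := (E.card : ℝ) * ℓ with hU6
    have hu1 : 0 ≤ U1 := by positivity
    have hu2 : 0 ≤ U2 := by positivity
    have hu3 : 0 ≤ U3 := by positivity
    have hu4 : 0 ≤ U4 := by positivity
    have hu5 : 0 ≤ U5 := by positivity
    have hu6 : 0 ≤ U6 := by positivity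
    have hu3' : η * x * m * (ρ * ℓ) ≤ U3 := by
      have h0 : 0 ≤ η * x * (ρ * ℓ) := by positivity
      calc η * x * m * (ρ * ℓ) = (η * x * (ρ * ℓ)) * m := by ring
        _ ≤ (η * x * (ρ * ℓ)) * (m + 1) := mul_le_mul_of_nonneg_left (by linarith only [hm0]) h0
        _ = U3 := by rw [hU3]; ring
    have hxℓT : U2 ≤ U5 := by
      rw [hU2, hU5]
      have : η * x * ℓ ≤ 1 * x * ℓ := by gcongr
      rw [one_mul] at this
      exact div_le_div_of_nonneg_right this hT0.le
    -- the target in units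
    have hRℓ : K * Rtot * ℓ = K * (U1 + U2 + U3 + U4 + x + U5 + U6) := by
      have hR₂ℓ : R₂ * ℓ = U4 := by
        rw [hR₂, hU4, div_mul_eq_mul_div, div_eq_iff (Real.sqrt_pos.mpr hℓ0).ne']
        calc (m + 1) * x * η ^ (-(1 / 12 : ℝ)) * ℓ
            = (m + 1) * x * η ^ (-(1 / 12 : ℝ)) * (Real.sqrt ℓ * Real.sqrt ℓ) := by rw [Real.mul_self_sqrt hℓ0.le]
          _ = (m + 1) * x * η ^ (-(1 / 12 : ℝ)) * Real.sqrt ℓ * Real.sqrt ℓ := by ring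
      have hxℓ : x / ℓ * ℓ = x := by field_simp
      calc K * Rtot * ℓ = K * (R₁ * ℓ + R₂ * ℓ + x / ℓ * ℓ + x / T * ℓ + E.card * ℓ) := by rw [hRtot]; ring
        _ = K * (U1 + U2 + U3 + U4 + x + U5 + U6) := by
            rw [hR₂ℓ, hxℓ, hR₁, hU1, hU2, hU3, hU5, hU6]
            ring
    -- the sum of the term estimates, in units
    have hsum : 17 * (2 * η * Bw * Real.log (α₁ / α₀)) * x + 17 * (8 * η * e5 * ℓN / T) * x +
        17 * ((94 * e5 / T) / α₀) * x + 17 * ((2 * η * e12 + 94 * e5 / T) / α₁) * x +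
        17 * (2 * F * Real.sqrt (2 * ℓ)) * x + 17 * (2 * Gh) * x + x * (η * (Real.log ℓ + 2)) +
        (3 * |C₂| + 10) * x + 2 * L * ((ν - 1) * x) + 2 * (E.card : ℝ) * Real.log (ν * x) ≤
        (68 * (e30 + e7) + 68 * e12 * (e30 + e7) + 4 * e30) * U1 + 272 * e5 * U2 + (140 * e12 + 2) * U3 +
          49 * cG * e12 * U4 + (3196 * e5 + 4794 * e12) * U5 + (2312 + (3 * |C₂| + 10)) * x + 4 * U6 := by
      have e3 : 17 * ((94 * e5 / T) / α₀) * x = 3196 * e5 * U5 := ht3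
      have h5 : 17 * (2 * F * Real.sqrt (2 * ℓ)) * x ≤ 49 * cG * e12 * U4 + 140 * e12 * U3 := by
        have := ht5
        have h136 : 140 * e12 * (η * x * m * (ρ * ℓ)) ≤ 140 * e12 * U3 := mul_le_mul_of_nonneg_left hu3' (by positivity)
        linarith only [this, h136]
      linarith only [ht1, ht2, e3, ht4, h5, ht6, ht7, ht8, ht9]
    -- the coefficients are `≤ K`
    have hpos : 0 ≤ e5 ∧ 0 ≤ e7 ∧ 0 ≤ e12 ∧ 0 ≤ e30 ∧ 0 ≤ cG ∧ 0 ≤ |C₂| :=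
      ⟨he5pos.le, he7pos.le, he12pos.le, he30pos.le, hcG0, abs_nonneg C₂⟩
    obtain ⟨p5, p7, p12, p30, pcG, pC⟩ := hpos
    have hc1 : 68 * (e30 + e7) + 68 * e12 * (e30 + e7) + 4 * e30 ≤ K := by
      rw [hK]; linarith only [hprod1, hprod2, hprod3, p5, p7, p12, p30, pcG, pC]
    have hc2 : 272 * e5 ≤ K := by rw [hK]; linarith only [hprod1, hprod2, hprod3, p5, p7, p12, p30, pcG, pC]
    have hc3 : 140 * e12 + 2 ≤ K := by rw [hK]; linarith only [hprod1, hprod2, hprod3, p5, p7, p12, p30, pcG, pC]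
    have hc4 : 49 * cG * e12 ≤ K := by rw [hK]; linarith only [hprod1, hprod2, hprod3, p5, p7, p12, p30, pcG, pC]
    have hc5 : 3196 * e5 + 4794 * e12 ≤ K := by
      rw [hK]; linarith only [hprod1, hprod2, hprod3, p5, p7, p12, p30, pcG, pC]
    have hc6 : 2312 + (3 * |C₂| + 10) ≤ K := by
      rw [hK]; linarith only [hprod1, hprod2, hprod3, p5, p7, p12, p30, pcG, pC]
    have hc7 : (4 : ℝ) ≤ K := by rw [hK]; linarith only [hprod1, hprod2, hprod3, p5, p7, p12, p30, pcG, pC]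
    have hs1 := mul_le_mul_of_nonneg_right hc1 hu1
    have hs2 := mul_le_mul_of_nonneg_right hc2 hu2
    have hs3 := mul_le_mul_of_nonneg_right hc3 hu3
    have hs4 := mul_le_mul_of_nonneg_right hc4 hu4
    have hs5 := mul_le_mul_of_nonneg_right hc5 hu5
    have hs6 := mul_le_mul_of_nonneg_right hc6 hx0.le
    have hs7 := mul_le_mul_of_nonneg_right hc7 hu6
    have hint0 : 0 ≤ ∫ u in Real.log 2..Real.log x, normShExp a ν u :=
      intervalIntegral.integral_nonneg (Real.log_le_log (by norm_num) (by linarith))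
        fun u _ => normShExp_nonneg a ν u
    calc ‖Sh a ν x‖ * ℓ ≤ x * (∫ u in Real.log 2..Real.log x, normShExp a ν u) +
          (3 * |C₂| + 10) * x + 2 * L * ((ν - 1) * x) + 2 * (E.card : ℝ) * Real.log (ν * x) := hII
      _ ≤ x * (17 * (∫ α in Set.Ioc α₀ 1, Iα α) + η * (Real.log ℓ + 2)) +
          (3 * |C₂| + 10) * x + 2 * L * ((ν - 1) * x) + 2 * (E.card : ℝ) * Real.log (ν * x) := by
          have := mul_le_mul_of_nonneg_left hB1 hx0.le
          rw [← hη] at this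
          linarith only [this]
      _ ≤ x * (17 * (2 * η * Bw * Real.log (α₁ / α₀) + 8 * η * e5 * ℓN / T + (94 * e5 / T) / α₀ +
            (2 * η * e12 + 94 * e5 / T) / α₁ + (2 * F * Real.sqrt (2 * ℓ) + 2 * Gh)) + η * (Real.log ℓ + 2)) +
          (3 * |C₂| + 10) * x + 2 * L * ((ν - 1) * x) + 2 * (E.card : ℝ) * Real.log (ν * x) := by
          gcongr
      _ = 17 * (2 * η * Bw * Real.log (α₁ / α₀)) * x + 17 * (8 * η * e5 * ℓN / T) * x +
            17 * ((94 * e5 / T) / α₀) * x + 17 * ((2 * η * e12 + 94 * e5 / T) / α₁) * x +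
            17 * (2 * F * Real.sqrt (2 * ℓ)) * x + 17 * (2 * Gh) * x + x * (η * (Real.log ℓ + 2)) +
            (3 * |C₂| + 10) * x + 2 * L * ((ν - 1) * x) + 2 * (E.card : ℝ) * Real.log (ν * x) := by ring
      _ ≤ (68 * (e30 + e7) + 68 * e12 * (e30 + e7) + 4 * e30) * U1 + 272 * e5 * U2 + (140 * e12 + 2) * U3 +
          49 * cG * e12 * U4 + (3196 * e5 + 4794 * e12) * U5 + (2312 + (3 * |C₂| + 10)) * x + 4 * U6 := hsum
      _ ≤ K * U1 + K * U2 + K * U3 + K * U4 + K * U5 + K * x + K * U6 := by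
          linarith only [hs1, hs2, hs3, hs4, hs5, hs6, hs7]
      _ = K * Rtot * ℓ := by rw [hRℓ]; ring
  -- divide by `log x`
  have hfinal : ‖Sh a ν x‖ ≤ K * Rtot := le_of_mul_le_mul_right hmain hℓ0
  simpa only [Sh, hRtot, hR₁, hR₂, hη, hm, hxN] using hfinal

end Restricted

end Halasz

end Literature.NumberTheory.LFunctions
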